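import Literature.Barriers.CriticalPhenomena.PositionSpaceRGNonGibbsianContours
import HarnessLib

/-!
# Barrier `PositionSpaceRGNonGibbsian`, Theorem 4.3 (decimation, spacing `b ≥ 3`): the twisted
# Peierls transformation and its energy balance

Companion file of `…PositionSpaceRGNonGibbsianContours.lean` (van Enter–Fernández–Sokal 1993,
§4.3.2 / App. B.5.3, made quantitative by a direct Peierls argument). For an external contour `S` of a
configuration `σ` of the system `⟨W(R'); ξ_p⟩` and the set `N` of sites of its `-` interior
components, the **twisted Peierls transformation** `σ ↦ σ'` (`newCfg`) sets the spin sites of `S`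
to `+1` and replaces the configuration on `N` by its image under the phase-exchanging symmetry
`T = (spin flip) ∘ (translation by b e₀)` (filling the rim with `+1`). This file proves the energy
balance

`H(σ') ≤ H(σ) - (2U - #∂'M - 2|k| - DEF)`-type estimates, assembled as
`H(σ) - H(σ') ≥ U/3`, `U ≥ |S| / (2r+1)^d`,

where `U` is the number of frustrated spin–spin bonds touching `S`: the spin–spin bonds inside `N`
cancel exactly under `T` (`sum_SS_inN_eq`), the image–spin bonds telescope to twice the image field
summed over `M = S⁻ ∪ (N ∩ spin sites)` (`sum_IE_ge`), which is controlled by the Peierls condition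
of `…PeierlsCondition.lean` (`sum_imgField_ge`), and the bounded defects at the free origin are
absorbed by the size of contours enclosing it (lines leaving the `r`-ball of a `-` site).

Everything is proved; no named facts (D-0014, D-0026).

## References

* A. C. D. van Enter, R. Fernández, A. D. Sokal, J. Stat. Phys. 72 (1993) 879–1167,
  arXiv:hep-lat/9210032 — §4.3.1 Step 2, §4.3.2, App. B.5.3 (B.71)–(B.78) [VanenterFernandezSokal1993].
* S. Friedli, Y. Velenik, *Statistical Mechanics of Lattice Systems*, CUP 2017, §3.7.2 (Lemma 3.36),
  §7.2–§7.3 (contours with labels; the Peierls argument for models with a symmetry) [FriedliVelenik2017].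
-/

noncomputable section

namespace Literature.Barriers.CriticalPhenomena.NonGibbs

open Finset Relation Literature.Probability.LatticeModels

namespace SpacingPeierls

variable {d : ℕ}

/-! ### The shift, the set `N`, and the transformed configuration -/

section Map

variable (d) in
/-- **The translation vector `b e₀`** of the phase-exchanging symmetry `T` (as a total function of
`d`, equal to `b • e₀` when `d ≥ 1`). [cite: VanenterFernandezSokal1993, §4.3.2 (the two ground states are translates)] -/
def shiftVec (b : ℕ) : Site d := fun i => if i.1 = 0 then (b : ℤ) else 0

/-- `shiftVec d b = b • e₀`. [folklore] -/
theorem shiftVec_eq (hd : 1 ≤ d) (b : ℕ) : shiftVec d b = (b : ℤ) • uvec ⟨0, hd⟩ := by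
  funext i
  simp only [shiftVec, Pi.smul_apply, uvec_apply, smul_eq_mul, mul_ite, mul_one, mul_zero]
  by_cases h : i = ⟨0, hd⟩
  · rw [if_pos h, if_pos (by rw [h])]
  · rw [if_neg h, if_neg (fun h' => h (Fin.ext h'))]

/-- **The set `N` of sites of the `-` components.** [cite: FriedliVelenik2017, §7.2.6 (interiors of type −)] -/
def minusSet (L : Finset (Finset (Site d))) : Finset (Site d) := L.biUnion id

/-- Membership in `minusSet`. [folklore] -/
theorem mem_minusSet {L : Finset (Finset (Site d))} {u : Site d} : u ∈ minusSet L ↔ ∃ A ∈ L, u ∈ A := by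
  simp [minusSet]

variable (b : ℕ) (S N : Finset (Site d)) (v : Site d)

/-- **The twisted Peierls transformation** `σ ↦ σ'`: genuine image spins unchanged; the spin sites
of the contour set to `+1`; on the `-` interior `N`, the symmetry `T` — the value at `u` is minus the
old value at `u - v` when `u - v ∈ N`, and `+1` (the `ω^{(+)}` filling) otherwise; everything else
unchanged. [cite: FriedliVelenik2017, Lemma 3.36 (erasing a contour); VanenterFernandezSokal1993, §4.3.2 (the two phases are translates)] -/
def newCfg (σ : SpinConfig (Site d)) : SpinConfig (Site d) := fun u =>
  if IsGImg b u then σ u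
  else if u ∈ S then 1
  else if u ∈ N then (if u - v ∈ N then -σ (u - v) else 1)
  else σ u

variable {b S N v}

/-- `σ'` at a genuine image site. [folklore] -/
theorem newCfg_of_isGImg (σ : SpinConfig (Site d)) {u : Site d} (hu : IsGImg b u) : newCfg b S N v σ u = σ u := by
  simp [newCfg, hu]

/-- `σ'` at a spin site of `S`. [cite: FriedliVelenik2017, Lemma 3.36] -/
theorem newCfg_of_mem_S (σ : SpinConfig (Site d)) {u : Site d} (hus : IsSpin b u) (hu : u ∈ S) : newCfg b S N v σ u = 1 := by
  simp [newCfg, isSpin_iff_not_isGImg.1 hus, hu]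

/-- `σ'` at a spin site of `N ∖ S` whose preimage lies in `N`. [cite: VanenterFernandezSokal1993, §4.3.2] -/
theorem newCfg_of_mem_N_of_mem (σ : SpinConfig (Site d)) {u : Site d} (hus : IsSpin b u) (huS : u ∉ S) (hu : u ∈ N)
    (huv : u - v ∈ N) : newCfg b S N v σ u = -σ (u - v) := by
  simp [newCfg, isSpin_iff_not_isGImg.1 hus, huS, hu, huv]

/-- `σ'` at a spin site of `N ∖ S` whose preimage lies outside `N` (the `+` filling). [cite: VanenterFernandezSokal1993, §4.3.2] -/
theorem newCfg_of_mem_N_of_not_mem (σ : SpinConfig (Site d)) {u : Site d} (hus : IsSpin b u) (huS : u ∉ S) (hu : u ∈ N)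
    (huv : u - v ∉ N) : newCfg b S N v σ u = 1 := by
  simp [newCfg, isSpin_iff_not_isGImg.1 hus, huS, hu, huv]

/-- `σ'` off `S ∪ N`. [folklore] -/
theorem newCfg_of_not_mem (σ : SpinConfig (Site d)) {u : Site d} (huS : u ∉ S) (huN : u ∉ N) : newCfg b S N v σ u = σ u := by
  unfold newCfg
  split_ifs <;> rfl

/-- `‖v‖_∞ ≤ b`: `supDist (u - v) u ≤ b`. [folklore] -/
theorem supDist_sub_shiftVec_le (b : ℕ) (u : Site d) : supDist (u - shiftVec d b) u ≤ b := by
  refine supDist_le_iff.2 fun i => ?_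
  simp only [Pi.sub_apply, shiftVec]
  split_ifs <;> simp

/-- `supDist u (u + v) ≤ b`. [folklore] -/
theorem supDist_add_shiftVec_le (b : ℕ) (u : Site d) : supDist u (u + shiftVec d b) ≤ b := by
  refine supDist_le_iff.2 fun i => ?_
  simp only [Pi.add_apply, shiftVec]
  split_ifs <;> simp

variable (b) in
/-- **The transformed configuration of the Peierls estimate**: `newCfg` with `N` the union of the
`-` components `L` and `v = b e₀`. [cite: FriedliVelenik2017, Lemma 3.36; VanenterFernandezSokal1993, §4.3.2] -/
abbrev tcfg (σ : SpinConfig (Site d)) (S : Finset (Site d)) (L : Finset (Finset (Site d))) : SpinConfig (Site d) :=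
  newCfg b S (minusSet L) (shiftVec d b) σ

end Map

/-! ### The data of an external contour with its labels -/

/-- **The data of the Peierls estimate**: a configuration of the system `⟨W(R'); ξ_p⟩`, an external
contour `S` (a nonempty `★`-connected component of the bad set with exterior label `+`) and the set
`L` of its `-` interior components. [cite: FriedliVelenik2017, §7.2.6 and §7.3 (external contours with labels)] -/
structure CtData (d b : ℕ) (p : ℤˣ) (R' r : ℕ) (σ : SpinConfig (Site d)) (S : Finset (Site d))
    (L : Finset (Finset (Site d))) : Prop where
  hd : 2 ≤ d
  hb : 3 ≤ b
  hr : b + 1 ≤ r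
  hrd : 72 * d ≤ r
  cfg : IsCfg b p R' σ
  ne : S.Nonempty
  conn : StarConn (S : Set (Site d))
  contour : IsContour b r σ S
  plusExt : IsPlusExt b r σ S
  Lsub : L ⊆ Comps S
  Lspec : ∀ A ∈ Comps S, A ∈ L ↔ IsMinusComp b r σ A

namespace CtData

variable {b : ℕ} {p : ℤˣ} {R' r : ℕ} {σ : SpinConfig (Site d)} {S : Finset (Site d)} {L : Finset (Finset (Site d))}
variable (h : CtData d b p R' r σ S L)
include h

/-- `d ≥ 1`. [folklore] -/
theorem hd1 : 1 ≤ d := le_trans (by norm_num) h.hd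
/-- `b ≥ 2`. [folklore] -/
theorem hb2 : 2 ≤ b := le_trans (by norm_num) h.hb
/-- `b > 0`. [folklore] -/
theorem hb0 : 0 < b := lt_of_lt_of_le (by norm_num) h.hb
/-- `r ≥ 2`. [folklore] -/
theorem hr2 : 2 ≤ r := le_trans (by have := h.hb; omega) h.hr
/-- `r ≥ 1`. [folklore] -/
theorem hr1 : 1 ≤ r := le_trans (by norm_num) h.hr2
/-- `b ≤ r`. [folklore] -/
theorem hbr : b ≤ r := le_trans (Nat.le_succ b) h.hr

/-- The direction `e₀`. [folklore] -/
def i₀ : Fin d := ⟨0, h.hd1⟩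

/-- The shift vector `v = b e₀`. [cite: VanenterFernandezSokal1993, §4.3.2] -/
theorem shiftVec_eq' : shiftVec d b = (b : ℤ) • uvec h.i₀ := shiftVec_eq h.hd1 b

/-! #### Members of `L` and of `N` -/

/-- Members of `L` are interior components. [cite: FriedliVelenik2017, §7.2.6] -/
theorem mem_Comps_of_mem_L {A : Finset (Site d)} (hA : A ∈ L) : A ∈ Comps S := h.Lsub hA

/-- Members of `L` are `-` components. [cite: FriedliVelenik2017, §7.2.6] -/
theorem isMinusComp_of_mem_L {A : Finset (Site d)} (hA : A ∈ L) : IsMinusComp b r σ A := (h.Lspec A (h.Lsub hA)).1 hA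

/-- Sites of `N` are not in `S` and not exterior. [cite: FriedliVelenik2017, §7.2.6] -/
theorem not_mem_S_of_mem_N {u : Site d} (hu : u ∈ minusSet L) : u ∉ S ∧ u ∉ starExt S := by
  obtain ⟨A, hA, huA⟩ := mem_minusSet.1 hu
  exact not_mem_of_mem_Comps h.hd (h.mem_Comps_of_mem_L hA) huA

/-- `N` is closed under `★`-steps avoiding `S`. [cite: FriedliVelenik2017, §7.2.6] -/
theorem mem_N_of_adj {u z : Site d} (hu : u ∈ minusSet L) (hadj : (zdStar d).Adj u z) (hz : z ∉ S) : z ∈ minusSet L := by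
  obtain ⟨A, hA, huA⟩ := mem_minusSet.1 hu
  exact mem_minusSet.2 ⟨A, hA, mem_of_mem_Comps_of_adj h.hd (h.mem_Comps_of_mem_L hA) huA hadj hz⟩

/-- A `★`-neighbour of `N` outside `N` lies in `S`. [cite: FriedliVelenik2017, §7.2.6] -/
theorem mem_S_of_adj_of_not_mem_N {u z : Site d} (hu : u ∈ minusSet L) (hadj : (zdStar d).Adj u z) (hz : z ∉ minusSet L) :
    z ∈ S := by
  by_contra hzS
  exact hz (h.mem_N_of_adj hu hadj hzS)

/-- **The rim lemma in `N`**: a spin site of `N` within sup-distance `r` of a point outside `N` carries `-1`.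
[cite: FriedliVelenik2017, §7.2.6] -/
theorem apply_eq_neg_one_of_mem_N {u y : Site d} (hu : u ∈ minusSet L) (hus : IsSpin b u) (hy : y ∉ minusSet L)
    (huy : supDist u y ≤ r) : σ u = -1 := by
  obtain ⟨A, hA, huA⟩ := mem_minusSet.1 hu
  exact apply_eq_neg_one_of_supDist_le h.hd h.contour (h.mem_Comps_of_mem_L hA) (h.isMinusComp_of_mem_L hA) huA hus
    (fun hyA => hy (mem_minusSet.2 ⟨A, hA, hyA⟩)) huy

/-- Sites of `N` lie well inside the box: `|u i| + r ≤ b R'`. [cite: VanenterFernandezSokal1993, §4.3.1 Step 2] -/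
theorem natAbs_add_le_of_mem_N {u : Site d} (hu : u ∈ minusSet L) (i : Fin d) : ((u i).natAbs : ℤ) + r ≤ b * R' := by
  obtain ⟨A, hA, huA⟩ := mem_minusSet.1 hu
  exact natAbs_add_le_of_mem_minusComp h.hd h.hb2 h.hr1 h.cfg h.contour (h.mem_Comps_of_mem_L hA) (h.isMinusComp_of_mem_L hA) huA i

/-- Spin sites of `N` lie in `W(R')`. [cite: VanenterFernandezSokal1993, §4.3.1 Step 2] -/
theorem mem_W_of_mem_N {u : Site d} (hu : u ∈ minusSet L) (hus : IsSpin b u) : u ∈ spacingVolume d b R' := by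
  obtain ⟨A, hA, huA⟩ := mem_minusSet.1 hu
  exact mem_spacingVolume_of_mem_minusComp h.hd h.hb2 h.hr1 h.cfg h.contour (h.mem_Comps_of_mem_L hA)
    (h.isMinusComp_of_mem_L hA) huA hus

/-- **Good neighbours of `S` outside `N` carry `+1`**: a spin site `★`-adjacent to `S`, not in `S ∪ N`,
has sign `+1` (exterior label, or the label of a `+` component) hence spin `+1`.
[cite: FriedliVelenik2017, §7.2.6 (labels)] -/
theorem apply_eq_one_of_adj_S {z s : Site d} (hs : s ∈ S) (hadj : (zdStar d).Adj s z) (hzS : z ∉ S) (hzN : z ∉ minusSet L)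
    (hzs : IsSpin b z) : σ z = 1 := by
  have hzex : z ∈ exBoundary S := mem_exBoundary.2 ⟨hzS, s, hs, hadj⟩
  have hgood : ¬ IsBad b r σ z := h.contour.2 z hzex
  have hsign : bsign b r σ z = 1 := by
    rcases mem_starExt_or_mem_starInt h.hd hzS with hext | hint
    · exact h.plusExt z hzex hext
    · obtain ⟨A, hA, hzA⟩ := exists_mem_Comps h.hd h.ne hint
      have hAL : A ∉ L := fun hAL => hzN (mem_minusSet.2 ⟨A, hAL, hzA⟩)
      have hnm : ¬ IsMinusComp b r σ A := fun hm => hAL ((h.Lspec A hA).2 hm)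
      exact bsign_eq_one_of_not_isMinusComp h.hd h.hb2 h.hr2 h.conn h.contour hA hnm
        (mem_inBoundary.2 ⟨hzA, s, fun hsA => (not_mem_of_mem_Comps h.hd hA hsA).1 hs, hadj.symm⟩)
  rw [apply_eq_bsign hgood (mem_supBall_self r z) hzs, hsign]

/-! #### Values of the transformed configuration -/

/-- **Near `S`, transformed spins of `N` are `+1`**: if `u ∈ N` is a spin site other than the origin
and `u - v` is within sup-distance `r` of a point of `S`, then `σ'(u) = +1` (either the filling, or
minus a rim value `-1`). [cite: VanenterFernandezSokal1993, §4.3.2; FriedliVelenik2017, §7.2.6] -/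
theorem σ'_eq_one_of_near {u : Site d} (hu : u ∈ minusSet L) (hus : IsSpin b u) (hu0 : u ≠ 0)
    (hnear : ∃ s ∈ S, supDist (u - shiftVec d b) s ≤ r) : tcfg b σ S L u = 1 := by
  have huS : u ∉ S := (h.not_mem_S_of_mem_N hu).1
  by_cases huv : u - shiftVec d b ∈ minusSet L
  · rw [tcfg, newCfg_of_mem_N_of_mem σ hus huS hu huv]
    obtain ⟨s, hs, hds⟩ := hnear
    have hsN : s ∉ minusSet L := fun hsN => (h.not_mem_S_of_mem_N hsN).1 hs
    have huvs : IsSpin b (u - shiftVec d b) := by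
      refine isSpin_of_not_isSpImageSite fun himg => ?_
      rw [h.shiftVec_eq', isSpImageSite_sub_bvec_iff] at himg
      exact not_isSpImageSite_of_isSpin hus hu0 himg
    rw [h.apply_eq_neg_one_of_mem_N huv huvs hsN hds, neg_neg]
  · rw [tcfg, newCfg_of_mem_N_of_not_mem σ hus huS hu huv]

/-- In particular **a spin site of `N` adjacent to `S` becomes `+1`**. [cite: FriedliVelenik2017, Lemma 3.36] -/
theorem σ'_eq_one_of_adj_S {u s : Site d} (hu : u ∈ minusSet L) (hus : IsSpin b u) (hu0 : u ≠ 0) (hs : s ∈ S)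
    (hadj : (zdStar d).Adj u s) : tcfg b σ S L u = 1 :=
  h.σ'_eq_one_of_near hu hus hu0 ⟨s, hs, by
    have h1 := supDist_sub_shiftVec_le b u
    have h2 := (zdStar_adj.1 hadj).2
    have := supDist_triangle (u - shiftVec d b) u s
    have := h.hr
    omega⟩

omit h in
/-- `σ'` agrees with `σ` at genuine image sites. [folklore] -/
theorem σ'_of_isGImg {u : Site d} (hu : IsGImg b u) : tcfg b σ S L u = σ u := newCfg_of_isGImg σ hu

omit h in
/-- `σ' = +1` on the spin sites of `S`. [cite: FriedliVelenik2017, Lemma 3.36] -/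
theorem σ'_of_mem_S {u : Site d} (hus : IsSpin b u) (hu : u ∈ S) : tcfg b σ S L u = 1 := newCfg_of_mem_S σ hus hu

omit h in
/-- `σ' = σ` off `S ∪ N`. [folklore] -/
theorem σ'_of_not_mem {u : Site d} (huS : u ∉ S) (huN : u ∉ minusSet L) : tcfg b σ S L u = σ u := newCfg_of_not_mem σ huS huN

/-- **`σ'` is a configuration of the system** (it agrees with `ξ_p` off `W(R')`).
[cite: VanenterFernandezSokal1993, §4.2 Step 2] -/
theorem isCfg_σ' : IsCfg b p R' (tcfg b σ S L) := by
  intro u huW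
  by_cases himg : IsGImg b u
  · rw [σ'_of_isGImg himg, h.cfg u huW]
  have hus : IsSpin b u := isSpin_iff_not_isGImg.2 himg
  by_cases huS : u ∈ S
  · rw [σ'_of_mem_S hus huS, ξb_of_isSpin_of_not_mem hus huW]
  have huN : u ∉ minusSet L := fun huN => huW (h.mem_W_of_mem_N huN hus)
  rw [σ'_of_not_mem huS huN, h.cfg u huW]

/-- `σ'` differs from `σ` only on spin sites of `(S ∪ N) ∩ W(R')`. [folklore] -/
theorem σ'_eq_of_not_mem_W {u : Site d} (hu : u ∉ spacingVolume d b R') : tcfg b σ S L u = σ u := by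
  rw [h.isCfg_σ' u hu, h.cfg u hu]

end CtData

/-! ### Oriented edges: bond values, spin–spin bonds, frustration -/

section Bonds

variable (b : ℕ)

/-- Symmetry of sup-ball membership. [folklore] -/
theorem mem_supBall_symm {r : ℕ} {x y : Site d} (hy : y ∈ supBall r x) : x ∈ supBall r y := by
  rw [mem_supBall] at hy ⊢; rwa [supDist_comm]

/-- The bond value `σ_x σ_{x+eᵢ}` of an oriented edge. [cite: FriedliVelenik2017, §3.1, eq. (3.2)] -/
def bondVal (σ : SpinConfig (Site d)) (q : Site d × Fin d) : ℝ := spinAt q.1 σ * spinAt (q.1 + uvec q.2) σ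

/-- **Spin–spin bonds**: both endpoints are spin sites. [cite: VanenterFernandezSokal1993, App. B.5.3 (internal-spin plaquettes)] -/
def VV (q : Site d × Fin d) : Prop := IsSpin b q.1 ∧ IsSpin b (q.1 + uvec q.2)

/-- **Internal spin–spin bonds**: both endpoints are internal sites (non-image). [cite: VanenterFernandezSokal1993, App. B.5.3] -/
def SS (q : Site d × Fin d) : Prop := ¬ IsSpImageSite d b q.1 ∧ ¬ IsSpImageSite d b (q.1 + uvec q.2)

/-- **Frustrated spin–spin bonds.** [cite: FriedliVelenik2017, §3.7.2 (contours separate opposite spins)] -/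
def Frus (σ : SpinConfig (Site d)) (q : Site d × Fin d) : Prop := VV b q ∧ σ q.1 ≠ σ (q.1 + uvec q.2)

/-- `VV` is decidable. [folklore] -/
instance (q : Site d × Fin d) : Decidable (VV (d := d) b q) := inferInstanceAs (Decidable (_ ∧ _))
/-- `SS` is decidable. [folklore] -/
instance (q : Site d × Fin d) : Decidable (SS (d := d) b q) := inferInstanceAs (Decidable (_ ∧ _))
/-- `Frus` is decidable. [folklore] -/
instance (σ : SpinConfig (Site d)) (q : Site d × Fin d) : Decidable (Frus (d := d) b σ q) := inferInstanceAs (Decidable (_ ∧ _))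

/-- **`U`, the number of frustrated spin–spin bonds touching `S`.** [cite: FriedliVelenik2017, Lemma 3.36 (|γ|)] -/
def frusCount (σ : SpinConfig (Site d)) (S : Finset (Site d)) : ℕ := #((oedges S).filter (Frus b σ))

variable {b}

/-- The bond value is `1` for equal spins and `-1` for opposite spins. [cite: FriedliVelenik2017, §3.1] -/
theorem bondVal_eq (σ : SpinConfig (Site d)) (q : Site d × Fin d) :
    bondVal σ q = if σ q.1 = σ (q.1 + uvec q.2) then 1 else -1 := by
  unfold bondVal spinAt
  rcases Int.units_eq_one_or (σ q.1) with h1 | h1 <;> rcases Int.units_eq_one_or (σ (q.1 + uvec q.2)) with h2 | h2 <;>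
    simp [h1, h2]

/-- `bondVal ≤ 1`. [folklore] -/
theorem bondVal_le_one (σ : SpinConfig (Site d)) (q : Site d × Fin d) : bondVal σ q ≤ 1 := by
  rw [bondVal_eq]; split_ifs <;> norm_num

/-- `-1 ≤ bondVal`. [folklore] -/
theorem neg_one_le_bondVal (σ : SpinConfig (Site d)) (q : Site d × Fin d) : -1 ≤ bondVal σ q := by
  rw [bondVal_eq]; split_ifs <;> norm_num

/-- A bond with both spins `+1` has value `1`. [folklore] -/
theorem bondVal_of_eq_one {σ : SpinConfig (Site d)} {q : Site d × Fin d} (h1 : σ q.1 = 1) (h2 : σ (q.1 + uvec q.2) = 1) :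
    bondVal σ q = 1 := by
  rw [bondVal_eq, h1, h2, if_pos rfl]

/-- A bond with both spins `-1` has value `1`. [folklore] -/
theorem bondVal_of_eq_neg_one {σ : SpinConfig (Site d)} {q : Site d × Fin d} (h1 : σ q.1 = -1) (h2 : σ (q.1 + uvec q.2) = -1) :
    bondVal σ q = 1 := by
  rw [bondVal_eq, h1, h2, if_pos rfl]

/-- For a spin–spin bond, `1 - bondVal = 2·𝟙[frustrated]`. [cite: FriedliVelenik2017, §3.7.2, eq. (3.36)] -/
theorem one_sub_bondVal_of_VV {σ : SpinConfig (Site d)} {q : Site d × Fin d} (hq : VV b q) :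
    1 - bondVal σ q = if Frus b σ q then 2 else 0 := by
  rw [bondVal_eq]
  by_cases h : σ q.1 = σ (q.1 + uvec q.2)
  · rw [if_pos h, if_neg (fun hf => hf.2 h)]; norm_num
  · rw [if_neg h, if_pos ⟨hq, h⟩]; norm_num

/-- A non-spin–spin bond of `ℤ^d` has exactly one genuine-image endpoint (`b ≥ 2`).
[cite: VanenterFernandezSokal1993, §4.1.2 Step 1] -/
theorem isGImg_or_of_not_VV (hb : 2 ≤ b) {q : Site d × Fin d} (hq : ¬ VV b q) :
    (IsGImg b q.1 ∧ IsSpin b (q.1 + uvec q.2)) ∨ (IsSpin b q.1 ∧ IsGImg b (q.1 + uvec q.2)) := by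
  by_cases h1 : IsSpin b q.1
  · right
    have h2 : ¬ IsSpin b (q.1 + uvec q.2) := fun h2 => hq ⟨h1, h2⟩
    exact ⟨h1, of_not_not fun hg => h2 (isSpin_iff_not_isGImg.2 hg)⟩
  · left
    have hg : IsGImg b q.1 := of_not_not fun hg => h1 (isSpin_iff_not_isGImg.2 hg)
    exact ⟨hg, isSpin_of_adj_isGImg hb hg (zdGraph_adj_add_uvec _ _)⟩

/-- `VV` is `SS` or an origin bond. [folklore] -/
theorem SS_or_of_VV {q : Site d × Fin d} (hq : VV b q) : SS b q ∨ (q.1 = 0 ∨ q.1 + uvec q.2 = 0) := by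
  by_cases h1 : q.1 = 0
  · exact Or.inr (Or.inl h1)
  by_cases h2 : q.1 + uvec q.2 = 0
  · exact Or.inr (Or.inr h2)
  exact Or.inl ⟨not_isSpImageSite_of_isSpin hq.1 h1, not_isSpImageSite_of_isSpin hq.2 h2⟩

/-- `SS` bonds are `VV` bonds. [folklore] -/
theorem VV_of_SS {q : Site d × Fin d} (hq : SS b q) : VV b q :=
  ⟨isSpin_of_not_isSpImageSite hq.1, isSpin_of_not_isSpImageSite hq.2⟩

/-- **The origin bonds**: the `2d` oriented edges with the origin as an endpoint. [cite: VanenterFernandezSokal1993, §4.1.2 Step 3] -/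
def originEdges (d : ℕ) : Finset (Site d × Fin d) :=
  (univ.image fun i : Fin d => ((0 : Site d), i)) ∪ univ.image fun i : Fin d => (-(uvec i : Site d), i)

/-- There are at most `2d` origin bonds. [cite: VanenterFernandezSokal1993, §4.1.2 Step 3] -/
theorem card_originEdges_le (d : ℕ) : #(originEdges d) ≤ 2 * d :=
  (card_union_le _ _).trans (by
    have h1 : #(univ.image fun i : Fin d => ((0 : Site d), i)) ≤ d := card_image_le.trans (by simp)
    have h2 : #(univ.image fun i : Fin d => (-(uvec i : Site d), i)) ≤ d := card_image_le.trans (by simp)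
    omega)

/-- A bond with the origin as an endpoint is an origin bond. [folklore] -/
theorem mem_originEdges {q : Site d × Fin d} (hq : q.1 = 0 ∨ q.1 + uvec q.2 = 0) : q ∈ originEdges d := by
  rw [originEdges, mem_union, mem_image, mem_image]
  rcases hq with h | h
  · exact Or.inl ⟨q.2, mem_univ _, by rw [← h]⟩
  · refine Or.inr ⟨q.2, mem_univ _, ?_⟩
    have : q.1 = -uvec q.2 := eq_neg_of_add_eq_zero_left h
    rw [← this]

/-- **The zero-field Hamiltonian as minus the sum of bond values over oriented edges.**
[cite: FriedliVelenik2017, §3.1, eqs. (3.2), (3.6)] -/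
theorem isingHamiltonian_eq_neg_sum_bondVal (Λ : Finset (Site d)) (η σ : SpinConfig (Site d)) :
    isingHamiltonian (zdGraph d) Λ 0 (.fixed η) σ = -∑ q ∈ oedges Λ, bondVal σ q :=
  isingHamiltonian_zdGraph_eq_neg_sum_oedges Λ η σ

/-- **Genuine image neighbours** of a site (image neighbours other than the origin). [cite: VanenterFernandezSokal1993, §4.3.2] -/
def gimgNbrs (b : ℕ) (z : Site d) : Finset (Site d) := (imgNbrs d b z).filter fun a => a ≠ 0

/-- Membership in `gimgNbrs`. [folklore] -/
theorem mem_gimgNbrs {z a : Site d} : a ∈ gimgNbrs b z ↔ (zdGraph d).Adj z a ∧ IsGImg b a := by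
  rw [gimgNbrs, mem_filter, mem_imgNbrs, IsGImg, and_assoc]

/-- **The genuine image field** `h'_z = ∑_{a ∼ z genuine image} ξ_a` (the field of the tree's
`imgField` without the contribution of the origin, which is a spin here).
[cite: VanenterFernandezSokal1993, §4.3.2 (the periodic magnetic field)] -/
def gField (b : ℕ) (ξ : SpinConfig (Site d)) (z : Site d) : ℝ := ∑ a ∈ gimgNbrs b z, spinAt a ξ

/-- The spin endpoint of a non-spin–spin bond. [folklore] -/
def spnEnd (b : ℕ) (q : Site d × Fin d) : Site d := if IsSpin b q.1 then q.1 else q.1 + uvec q.2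

/-- The image endpoint of a non-spin–spin bond. [folklore] -/
def imgEnd (b : ℕ) (q : Site d × Fin d) : Site d := if IsSpin b q.1 then q.1 + uvec q.2 else q.1

/-- The endpoints of a non-spin–spin bond: a spin site and an adjacent genuine image site.
[cite: VanenterFernandezSokal1993, §4.1.2 Step 1] -/
theorem spnEnd_imgEnd_spec (hb : 2 ≤ b) {q : Site d × Fin d} (hq : ¬ VV b q) :
    IsSpin b (spnEnd b q) ∧ IsGImg b (imgEnd b q) ∧ (zdGraph d).Adj (spnEnd b q) (imgEnd b q) ∧
      s(spnEnd b q, imgEnd b q) = s(q.1, q.1 + uvec q.2) := by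
  unfold spnEnd imgEnd
  rcases isGImg_or_of_not_VV hb hq with ⟨h1, h2⟩ | ⟨h1, h2⟩
  · have : ¬ IsSpin b q.1 := fun h => (isSpin_iff_not_isGImg.1 h) h1
    rw [if_neg this, if_neg this]
    exact ⟨h2, h1, (zdGraph_adj_add_uvec _ _).symm, Sym2.eq_swap⟩
  · rw [if_pos h1, if_pos h1]
    exact ⟨h1, h2, zdGraph_adj_add_uvec _ _, rfl⟩

/-- **Reindexing the image–spin bonds by their spin endpoint**: a sum over the non-spin–spin oriented
edges touching `X` of a quantity `F (spin endpoint) (image endpoint)` vanishing when the spin endpoint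
is outside `X` equals `∑_{z ∈ X spin} ∑_{a ∼ z genuine image} F z a`.
[cite: VanenterFernandezSokal1993, App. B.5.3 (ΔE₊, ΔE₋ as sums over image–spin bonds)] -/
theorem sum_filter_not_VV_eq (hb : 2 ≤ b) (X : Finset (Site d)) (F : Site d → Site d → ℝ) (G : Site d × Fin d → ℝ)
    (hG : ∀ q ∈ (oedges X).filter (fun q => ¬ VV b q), G q = F (spnEnd b q) (imgEnd b q))
    (hF : ∀ z a, z ∉ X → F z a = 0) :
    ∑ q ∈ (oedges X).filter (fun q => ¬ VV b q), G q = ∑ z ∈ X.filter (IsSpin b), ∑ a ∈ gimgNbrs b z, F z a := by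
  classical
  set T := (oedges X).filter (fun q => ¬ VV b q) with hT
  have hends : ∀ q ∈ T, IsSpin b (spnEnd b q) ∧ IsGImg b (imgEnd b q) ∧ (zdGraph d).Adj (spnEnd b q) (imgEnd b q) ∧
      s(spnEnd b q, imgEnd b q) = s(q.1, q.1 + uvec q.2) := fun q hq => spnEnd_imgEnd_spec hb (mem_filter.1 hq).2
  -- drop the bonds whose spin endpoint is outside `X`
  rw [← sum_filter_add_sum_filter_not T (fun q => spnEnd b q ∈ X)]
  have hzero : ∑ q ∈ T.filter (fun q => ¬ spnEnd b q ∈ X), G q = 0 :=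
    sum_eq_zero fun q hq => by
      obtain ⟨hqT, hq⟩ := mem_filter.1 hq
      rw [hG q hqT, hF _ _ hq]
  rw [hzero, add_zero, sum_sigma' (X.filter (IsSpin b)) (fun z => gimgNbrs b z) F]
  -- bijection with the incidence pairs `⟨z, a⟩`
  refine sum_bij (fun q _ => ⟨spnEnd b q, imgEnd b q⟩) (fun q hq => ?_) (fun q hq q' hq' hqq' => ?_) (fun za hza => ?_)
    (fun q hq => hG q (mem_filter.1 hq).1)
  · obtain ⟨hqT, hqX⟩ := mem_filter.1 hq
    obtain ⟨hs, hi, hadj, -⟩ := hends q hqT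
    exact mem_sigma.2 ⟨mem_filter.2 ⟨hqX, hs⟩, mem_gimgNbrs.2 ⟨hadj, hi⟩⟩
  · obtain ⟨hqT, -⟩ := mem_filter.1 hq
    obtain ⟨hqT', -⟩ := mem_filter.1 hq'
    simp only [Sigma.mk.inj_iff, heq_eq_eq] at hqq'
    have e1 := (hends q hqT).2.2.2
    have e2 := (hends q' hqT').2.2.2
    rw [hqq'.1, hqq'.2, e2] at e1
    exact oedgeToSym2_injective e1.symm
  · obtain ⟨z, a⟩ := za
    obtain ⟨hz, ha⟩ := mem_sigma.1 hza
    simp only at hz ha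
    obtain ⟨hzX, hzs⟩ := mem_filter.1 hz
    obtain ⟨hadj, haimg⟩ := mem_gimgNbrs.1 ha
    have hans : ¬ IsSpin b a := fun h => (isSpin_iff_not_isGImg.1 h) haimg
    obtain ⟨i, hi | hi⟩ := exists_uvec_of_adj hadj
    · have hq : ¬ VV b (z, i) := fun hv => hans (by rw [hi]; exact hv.2)
      refine ⟨(z, i), mem_filter.2 ⟨mem_filter.2 ⟨mem_oedges.2 (Or.inl hzX), hq⟩, ?_⟩, ?_⟩
      · show spnEnd b (z, i) ∈ X
        rw [spnEnd, if_pos hzs]; exact hzX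
      · show (⟨spnEnd b (z, i), imgEnd b (z, i)⟩ : Σ _ : Site d, Site d) = ⟨z, a⟩
        rw [spnEnd, imgEnd, if_pos hzs, if_pos hzs, hi]
    · have hq : ¬ VV b (a, i) := fun hv => hans hv.1
      have hzX' : (a, i).1 + uvec (a, i).2 ∈ X := by rw [← hi]; exact hzX
      refine ⟨(a, i), mem_filter.2 ⟨mem_filter.2 ⟨mem_oedges.2 (Or.inr hzX'), hq⟩, ?_⟩, ?_⟩
      · show spnEnd b (a, i) ∈ X
        rw [spnEnd, if_neg hans, ← hi]; exact hzX
      · show (⟨spnEnd b (a, i), imgEnd b (a, i)⟩ : Σ _ : Site d, Site d) = ⟨z, a⟩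
        rw [spnEnd, imgEnd, if_neg hans, if_neg hans, ← hi]

end Bonds

/-! ### (U2) Petals of the origin inside a finite set have three boundary exits each -/

section PetalExits

variable {b : ℕ}

/-- Among `n + 1` values of an injective sequence, one lies outside a finite set of size `n`.
[folklore] -/
theorem exists_succ_not_mem_of_card {M : Finset (Site d)} (γ : ℕ → Site d) (hγ : Function.Injective γ) :
    ∃ n, γ (n + 1) ∉ M := by
  classical
  by_contra hall
  push Not at hall
  have := Finset.card_le_card_of_injOn (s := (univ : Finset (Fin (#M + 1)))) (t := M) (fun i => γ (i.1 + 1))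
    (fun i _ => hall i.1) (fun i _ i' _ hh => Fin.ext (by have := hγ hh; omega))
  simp at this

/-- The first coordinate direction `e₀` and the second `e₁` (`d ≥ 2`). [folklore] -/
def ax0 (hd : 2 ≤ d) : Fin d := ⟨0, by omega⟩
/-- The second coordinate direction (`d ≥ 2`). [folklore] -/
def ax1 (hd : 2 ≤ d) : Fin d := ⟨1, by omega⟩

/-- `e₀ ≠ e₁`. [folklore] -/
theorem ax0_ne_ax1 (hd : 2 ≤ d) : ax0 hd ≠ ax1 hd := by simp [ax0, ax1, Fin.ext_iff]

/-- **A direction perpendicular to a petal** `w = ± eⱼ` of the origin: `e₀` if `w ⊥ e₀`, else `e₁`. [folklore] -/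
def perpDir (hd : 2 ≤ d) (w : Site d) : Fin d := if w (ax0 hd) = 0 then ax0 hd else ax1 hd

/-- A petal of the origin is `s eⱼ` with `s = ±1`. [cite: VanenterFernandezSokal1993, §4.1.2 Step 3] -/
theorem exists_of_mem_petals {w : Site d} (hw : w ∈ (zdGraph d).neighborFinset 0) :
    ∃ j : Fin d, ∃ s : ℤ, (s = 1 ∨ s = -1) ∧ w = s • uvec j := by
  rw [SimpleGraph.mem_neighborFinset] at hw
  obtain ⟨⟨j, s⟩, hs, hw⟩ := exists_axisSign_of_adj hw
  exact ⟨j, s, hs, by rw [hw, zero_add]⟩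

/-- Coordinates of a petal. [folklore] -/
theorem petal_apply {j : Fin d} {s : ℤ} (i : Fin d) : (s • uvec j : Site d) i = if i = j then s else 0 := by
  rw [Pi.smul_apply, uvec_apply, smul_eq_mul, mul_ite, mul_one, mul_zero]

/-- The perpendicular direction of a petal is not its axis. [folklore] -/
theorem perpDir_ne (hd : 2 ≤ d) {j : Fin d} {s : ℤ} (hs : s = 1 ∨ s = -1) : perpDir hd (s • uvec j : Site d) ≠ j := by
  unfold perpDir
  rw [petal_apply]
  by_cases h0 : ax0 hd = j
  · rw [if_pos h0, if_neg (by rcases hs with rfl | rfl <;> norm_num), ← h0]; exact (ax0_ne_ax1 hd).symm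
  · rw [if_neg h0, if_pos rfl]; exact h0

/-- A multiple `t • (s eⱼ)` has coordinate `t s` at `j` and `0` elsewhere. [folklore] -/
theorem smul_petal_apply (t : ℤ) {j : Fin d} {s : ℤ} (i : Fin d) : (t • (s • uvec j : Site d)) i = if i = j then t * s else 0 := by
  rw [Pi.smul_apply, petal_apply, smul_eq_mul, mul_ite, mul_zero]

/-- A point whose `j`-th coordinate is not divisible by `b` is not an image site. [folklore] -/
theorem not_isSpImageSite_of_not_dvd {x : Site d} (j : Fin d) (hx : ¬ (b : ℤ) ∣ x j) : ¬ IsSpImageSite d b x :=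
  fun himg => hx (himg j)

/-- `±1` is not divisible by `b ≥ 2`. [folklore] -/
theorem not_dvd_sign (hb : 2 ≤ b) {s : ℤ} (hs : s = 1 ∨ s = -1) : ¬ (b : ℤ) ∣ s := by
  rcases hs with rfl | rfl
  · intro hh; have := Int.le_of_dvd one_pos hh; omega
  · rw [Int.dvd_neg]; intro hh; have := Int.le_of_dvd one_pos hh; omega

/-- `t s` with `1 ≤ t ≤ b - 1` is not divisible by `b`. [folklore] -/
theorem not_dvd_mul_sign {t : ℤ} (ht1 : 1 ≤ t) (ht2 : t ≤ b - 1) {s : ℤ} (hs : s = 1 ∨ s = -1) : ¬ (b : ℤ) ∣ t * s := by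
  rcases hs with rfl | rfl
  · rw [mul_one]; intro hh; have := Int.le_of_dvd (by omega) hh; omega
  · rw [mul_neg_one, Int.dvd_neg]; intro hh; have := Int.le_of_dvd (by omega) hh; omega

variable (b)

/-- **The three exits of a petal** `w` of the origin in a finite set `M`, as boundary pairs of `M`
towards internal sites: (1) the forward exit on the line through `w` perpendicular to its axis;
(2) the backward exit on that line; (3) the first exit along the axis ray `w, 2w, …` if it occurs
before the image site `b w`, else the forward perpendicular exit from `2w`. (A finite set is left by
every ray; the rays used here consist of internal sites for `b ≥ 3`.)
[cite: VanenterFernandezSokal1993, App. B.5.3 (boundary plaquettes near an image spin)] -/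
def exit1 (hd : 2 ≤ d) (M : Finset (Site d)) (w : Site d) : Site d × Site d :=
  open Classical in
  if hw : w ∈ M then
    let t := (exists_ray_exit_add M hw (perpDir hd w)).choose
    (w + (t : ℤ) • uvec (perpDir hd w), w + ((t : ℤ) + 1) • uvec (perpDir hd w))
  else (0, 0)

/-- The backward perpendicular exit of a petal. [cite: VanenterFernandezSokal1993, App. B.5.3] -/
def exit2 (hd : 2 ≤ d) (M : Finset (Site d)) (w : Site d) : Site d × Site d :=
  open Classical in
  if hw : w ∈ M then
    let t := (exists_ray_exit_sub M hw (perpDir hd w)).choose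
    (w - (t : ℤ) • uvec (perpDir hd w), w - ((t : ℤ) + 1) • uvec (perpDir hd w))
  else (0, 0)

/-- The axial (or rod) exit of a petal. [cite: VanenterFernandezSokal1993, App. B.5.3] -/
def exit3 (hd : 2 ≤ d) (M : Finset (Site d)) (w : Site d) : Site d × Site d :=
  open Classical in
  if hax : ∃ t : ℕ, t + 2 ≤ b - 1 ∧ ((t : ℤ) + 2) • w ∉ M then
    let t := Nat.find hax
    (((t : ℤ) + 1) • w, ((t : ℤ) + 2) • w)
  else if h2 : (2 : ℤ) • w ∈ M then
    let t := (exists_ray_exit_add M h2 (perpDir hd w)).choose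
    ((2 : ℤ) • w + (t : ℤ) • uvec (perpDir hd w), (2 : ℤ) • w + ((t : ℤ) + 1) • uvec (perpDir hd w))
  else (0, 0)

variable {b}

/-- Specification of `exit1`. [folklore] -/
theorem exit1_spec (hd : 2 ≤ d) {M : Finset (Site d)} {w : Site d} (hw : w ∈ M) :
    ∃ t : ℕ, exit1 hd M w = (w + (t : ℤ) • uvec (perpDir hd w), w + ((t : ℤ) + 1) • uvec (perpDir hd w)) ∧
      w + (t : ℤ) • uvec (perpDir hd w) ∈ M ∧ w + ((t : ℤ) + 1) • uvec (perpDir hd w) ∉ M := by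
  classical
  refine ⟨(exists_ray_exit_add M hw (perpDir hd w)).choose, by rw [exit1, dif_pos hw], (exists_ray_exit_add M hw (perpDir hd w)).choose_spec⟩

/-- Specification of `exit2`. [folklore] -/
theorem exit2_spec (hd : 2 ≤ d) {M : Finset (Site d)} {w : Site d} (hw : w ∈ M) :
    ∃ t : ℕ, exit2 hd M w = (w - (t : ℤ) • uvec (perpDir hd w), w - ((t : ℤ) + 1) • uvec (perpDir hd w)) ∧
      w - (t : ℤ) • uvec (perpDir hd w) ∈ M ∧ w - ((t : ℤ) + 1) • uvec (perpDir hd w) ∉ M := by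
  classical
  refine ⟨(exists_ray_exit_sub M hw (perpDir hd w)).choose, by rw [exit2, dif_pos hw], (exists_ray_exit_sub M hw (perpDir hd w)).choose_spec⟩

/-- Specification of `exit3`: either an axial exit `((t+1) w, (t+2) w)` with `t + 2 ≤ b - 1`, or (when the
whole rod `w, …, (b-1) w` lies in `M`, so that `2 w ∈ M` for `b ≥ 3`) the forward perpendicular exit
from `2 w`. [folklore] -/
theorem exit3_spec (hd : 2 ≤ d) (hb : 3 ≤ b) {M : Finset (Site d)} {w : Site d} (hw : w ∈ M) :
    (∃ t : ℕ, t + 2 ≤ b - 1 ∧ exit3 b hd M w = (((t : ℤ) + 1) • w, ((t : ℤ) + 2) • w) ∧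
        ((t : ℤ) + 1) • w ∈ M ∧ ((t : ℤ) + 2) • w ∉ M) ∨
      (∃ t : ℕ, exit3 b hd M w = ((2 : ℤ) • w + (t : ℤ) • uvec (perpDir hd w), (2 : ℤ) • w + ((t : ℤ) + 1) • uvec (perpDir hd w)) ∧
        (2 : ℤ) • w + (t : ℤ) • uvec (perpDir hd w) ∈ M ∧ (2 : ℤ) • w + ((t : ℤ) + 1) • uvec (perpDir hd w) ∉ M) := by
  classical
  by_cases hax : ∃ t : ℕ, t + 2 ≤ b - 1 ∧ ((t : ℤ) + 2) • w ∉ M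
  · left
    refine ⟨Nat.find hax, (Nat.find_spec hax).1, by rw [exit3, dif_pos hax], ?_, (Nat.find_spec hax).2⟩
    rcases Nat.eq_zero_or_pos (Nat.find hax) with h0 | hpos
    · rw [h0]; simpa using hw
    · have hmin := Nat.find_min hax (m := Nat.find hax - 1) (by omega)
      rw [not_and_or, not_not] at hmin
      rcases hmin with hmin | hmin
      · exact absurd (by have := (Nat.find_spec hax).1; omega : Nat.find hax - 1 + 2 ≤ b - 1) hmin
      · have : (((Nat.find hax - 1 : ℕ) : ℤ) + 2) = (Nat.find hax : ℤ) + 1 := by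
          rw [Nat.cast_sub (by omega : 1 ≤ Nat.find hax)]; push_cast; ring
        rwa [this] at hmin
  · right
    have h2 : (2 : ℤ) • w ∈ M := by
      push Not at hax
      have := hax 0 (by omega)
      simpa using this
    refine ⟨(exists_ray_exit_add M h2 (perpDir hd w)).choose, by rw [exit3, dif_neg hax, dif_pos h2],
      (exists_ray_exit_add M h2 (perpDir hd w)).choose_spec⟩

/-- **The exits of petals are boundary pairs of `M` towards internal sites** (`b ≥ 3`).
[cite: VanenterFernandezSokal1993, App. B.5.3] -/
theorem exits_mem_ffBdryPairs (hd : 2 ≤ d) (hb : 3 ≤ b) {M : Finset (Site d)} {w : Site d}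
    (hwP : w ∈ (zdGraph d).neighborFinset 0) (hw : w ∈ M) :
    exit1 hd M w ∈ ffBdryPairs d b M ∧ exit2 hd M w ∈ ffBdryPairs d b M ∧ exit3 b hd M w ∈ ffBdryPairs d b M := by
  obtain ⟨j, s, hs, rfl⟩ := exists_of_mem_petals hwP
  have hπ := perpDir_ne hd (j := j) hs
  have hb2 : 2 ≤ b := by omega
  -- the `j`-th coordinate along the perpendicular lines is `c s`, so no image sites there
  have hcoord : ∀ (c t : ℤ), (c • (s • uvec j : Site d) + t • uvec (perpDir hd (s • uvec j : Site d))) j = c * s := fun c t => by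
    rw [Pi.add_apply, smul_petal_apply, if_pos rfl, Pi.smul_apply, uvec_apply, if_neg hπ.symm]; simp
  refine ⟨?_, ?_, ?_⟩
  · obtain ⟨t, he, hin, hout⟩ := exit1_spec hd hw
    rw [he]
    refine mem_ffBdryPairs.2 ⟨hin, hout, not_isSpImageSite_of_not_dvd j ?_, ?_⟩
    · show ¬ (b : ℤ) ∣ ((s • uvec j : Site d) + ((t : ℤ) + 1) • uvec (perpDir hd (s • uvec j : Site d))) j
      have := hcoord 1 ((t : ℤ) + 1); rw [one_smul, one_mul] at this; rw [this]; exact not_dvd_sign hb2 hs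
    · show (zdGraph d).Adj ((s • uvec j : Site d) + (t : ℤ) • uvec (perpDir hd (s • uvec j : Site d)))
        ((s • uvec j : Site d) + ((t : ℤ) + 1) • uvec (perpDir hd (s • uvec j : Site d)))
      rw [add_smul, one_smul, ← add_assoc]; exact zdGraph_adj_add_uvec _ _
  · obtain ⟨t, he, hin, hout⟩ := exit2_spec hd hw
    rw [he]
    refine mem_ffBdryPairs.2 ⟨hin, hout, not_isSpImageSite_of_not_dvd j ?_, ?_⟩
    · show ¬ (b : ℤ) ∣ ((s • uvec j : Site d) - ((t : ℤ) + 1) • uvec (perpDir hd (s • uvec j : Site d))) j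
      have := hcoord 1 (-((t : ℤ) + 1)); rw [one_smul, one_mul, neg_smul, ← sub_eq_add_neg] at this; rw [this]
      exact not_dvd_sign hb2 hs
    · show (zdGraph d).Adj ((s • uvec j : Site d) - (t : ℤ) • uvec (perpDir hd (s • uvec j : Site d)))
        ((s • uvec j : Site d) - ((t : ℤ) + 1) • uvec (perpDir hd (s • uvec j : Site d)))
      rw [add_smul, one_smul, sub_add_eq_sub_sub]; exact zdGraph_adj_sub_uvec' _ _
  · rcases exit3_spec hd hb hw with ⟨t, htb, he, hin, hout⟩ | ⟨t, he, hin, hout⟩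
    · rw [he]
      refine mem_ffBdryPairs.2 ⟨hin, hout, not_isSpImageSite_of_not_dvd j ?_, ?_⟩
      · show ¬ (b : ℤ) ∣ (((t : ℤ) + 2) • (s • uvec j : Site d)) j
        rw [smul_petal_apply, if_pos rfl]; exact not_dvd_mul_sign (by omega) (by omega) hs
      · show (zdGraph d).Adj (((t : ℤ) + 1) • (s • uvec j : Site d)) (((t : ℤ) + 2) • (s • uvec j : Site d))
        have : ((t : ℤ) + 2) • (s • uvec j : Site d) = ((t : ℤ) + 1) • (s • uvec j : Site d) + s • (Pi.single j (1 : ℤ) : Site d) := by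
          rw [show (t : ℤ) + 2 = ((t : ℤ) + 1) + 1 by ring, add_smul, one_smul]
        rw [this]; exact zdGraph_adj_add_zsmul_single _ j hs
    · rw [he]
      refine mem_ffBdryPairs.2 ⟨hin, hout, not_isSpImageSite_of_not_dvd j ?_, ?_⟩
      · show ¬ (b : ℤ) ∣ ((2 : ℤ) • (s • uvec j : Site d) + ((t : ℤ) + 1) • uvec (perpDir hd (s • uvec j : Site d))) j
        rw [hcoord 2 ((t : ℤ) + 1)]; exact not_dvd_mul_sign (by norm_num) (by omega) hs
      · show (zdGraph d).Adj ((2 : ℤ) • (s • uvec j : Site d) + (t : ℤ) • uvec (perpDir hd (s • uvec j : Site d)))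
          ((2 : ℤ) • (s • uvec j : Site d) + ((t : ℤ) + 1) • uvec (perpDir hd (s • uvec j : Site d)))
        rw [add_smul, one_smul, ← add_assoc]; exact zdGraph_adj_add_uvec _ _

/-- Zeroing the `π`-coordinate undoes steps in direction `π`. [folklore] -/
theorem lineKey_add_zsmul (π : Fin d) (x : Site d) (t : ℤ) : lineKey π (x + t • uvec π) = lineKey π x :=
  lineKey_eq_iff.2 fun j hj => by rw [Pi.add_apply, Pi.smul_apply, uvec_apply, if_neg hj, smul_zero, add_zero]

/-- Zeroing the `π`-coordinate undoes steps in direction `-π`. [folklore] -/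
theorem lineKey_sub_zsmul (π : Fin d) (x : Site d) (t : ℤ) : lineKey π (x - t • uvec π) = lineKey π x := by
  rw [sub_eq_add_neg, ← neg_smul, lineKey_add_zsmul]

/-- `lineKey π x = x` when `x π = 0`. [folklore] -/
theorem lineKey_eq_self {π : Fin d} {x : Site d} (hx : x π = 0) : lineKey π x = x := by
  rw [lineKey, ← hx, Function.update_eq_self]

/-- `lineKey π (t e_π) = 0`. [folklore] -/
theorem lineKey_zsmul_uvec (π : Fin d) (t : ℤ) : lineKey π (t • uvec π : Site d) = 0 := by
  have := lineKey_add_zsmul π (0 : Site d) t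
  rw [zero_add] at this
  rw [this, lineKey_eq_self (by simp)]

/-- A petal is nonzero. [folklore] -/
theorem petal_ne_zero {j : Fin d} {s : ℤ} (hs : s = 1 ∨ s = -1) : (s • uvec j : Site d) ≠ 0 := by
  intro h0
  have := congrFun h0 j
  rw [petal_apply, if_pos rfl, Pi.zero_apply] at this
  rcases hs with rfl | rfl <;> norm_num at this

/-- A petal is not twice a petal. [folklore] -/
theorem petal_ne_two_smul {j j' : Fin d} {s s' : ℤ} (hs : s = 1 ∨ s = -1) (hs' : s' = 1 ∨ s' = -1) :
    (s • uvec j : Site d) ≠ (2 : ℤ) • (s' • uvec j' : Site d) := by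
  intro hh
  have := congrFun hh j
  rw [petal_apply, if_pos rfl, smul_petal_apply] at this
  split_ifs at this <;> rcases hs with rfl | rfl <;> rcases hs' with rfl | rfl <;> norm_num at this

/-- **Three pairwise disjoint injective families of exits**, hence `3k ≤ #∂M`: for every finite set
`M ⊆ ℤ^d` (`d ≥ 2`, `b ≥ 3`), three times the number of petals of the origin inside `M` is at most the
number of boundary pairs of `M` towards internal sites.
[cite: VanenterFernandezSokal1993, App. B.5.3 (every contour plaquette near an image spin is paid for)] -/
theorem three_mul_card_petals_le (hd : 2 ≤ d) (hb : 3 ≤ b) (M : Finset (Site d)) :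
    3 * #(M ∩ (zdGraph d).neighborFinset 0) ≤ #(ffBdryPairs d b M) := by
  classical
  set P := M ∩ (zdGraph d).neighborFinset 0 with hP
  have hPmem : ∀ w ∈ P, w ∈ M ∧ w ∈ (zdGraph d).neighborFinset 0 := fun w hw => mem_inter.1 hw
  -- per petal: nonzero, `π`-coordinate zero, step structure of the three exits
  have pf : ∀ w ∈ P, w ≠ 0 ∧ w (perpDir hd w) = 0 ∧ (∃ (j : Fin d) (s : ℤ), (s = 1 ∨ s = -1) ∧ w = s • uvec j) := by
    intro w hw
    obtain ⟨j, s, hs, rfl⟩ := exists_of_mem_petals (hPmem w hw).2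
    exact ⟨petal_ne_zero hs, by rw [petal_apply, if_neg (perpDir_ne hd hs)], j, s, hs, rfl⟩
  -- family 1: `(x, x + e_π)` with `lineKey π x = w`
  have sp1 : ∀ w ∈ P, ∃ x : Site d, exit1 hd M w = (x, x + uvec (perpDir hd w)) ∧ lineKey (perpDir hd w) x = w := by
    intro w hw
    obtain ⟨t, he, -, -⟩ := exit1_spec hd (hPmem w hw).1
    refine ⟨w + (t : ℤ) • uvec (perpDir hd w), by rw [he, add_smul, one_smul, add_assoc], ?_⟩
    rw [lineKey_add_zsmul, lineKey_eq_self (pf w hw).2.1]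
  -- family 2: `(x, x - e_π)` with `lineKey π x = w`
  have sp2 : ∀ w ∈ P, ∃ x : Site d, exit2 hd M w = (x, x - uvec (perpDir hd w)) ∧ lineKey (perpDir hd w) x = w := by
    intro w hw
    obtain ⟨t, he, -, -⟩ := exit2_spec hd (hPmem w hw).1
    refine ⟨w - (t : ℤ) • uvec (perpDir hd w), by rw [he, add_smul, one_smul, sub_add_eq_sub_sub], ?_⟩
    rw [lineKey_sub_zsmul, lineKey_eq_self (pf w hw).2.1]
  -- family 3: `(t w, t w + w)` with `t ≥ 1`, or `(x, x + e_π)` with `lineKey π x = 2 w`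
  have sp3 : ∀ w ∈ P, (∃ t : ℤ, 1 ≤ t ∧ exit3 b hd M w = (t • w, t • w + w)) ∨
      ∃ x : Site d, exit3 b hd M w = (x, x + uvec (perpDir hd w)) ∧ lineKey (perpDir hd w) x = (2 : ℤ) • w := by
    intro w hw
    rcases exit3_spec hd hb (hPmem w hw).1 with ⟨t, -, he, -, -⟩ | ⟨t, he, -, -⟩
    · left; refine ⟨(t : ℤ) + 1, by omega, ?_⟩
      rw [he, show (t : ℤ) + 2 = ((t : ℤ) + 1) + 1 by ring, add_smul ((t : ℤ) + 1) 1, one_smul]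
    · right
      refine ⟨(2 : ℤ) • w + (t : ℤ) • uvec (perpDir hd w), by rw [he, add_smul, one_smul, add_assoc], ?_⟩
      rw [lineKey_add_zsmul, lineKey_eq_self]
      rw [Pi.smul_apply, (pf w hw).2.1, smul_zero]
  -- a step `e_π` equal to a petal `w'` forces `w' = e_π`, and then `t w'` has `lineKey π = 0`
  have key3A : ∀ (π : Fin d) (w' : Site d) (t : ℤ), (uvec π : Site d) = w' ∨ -(uvec π : Site d) = w' →
      lineKey π (t • w') = 0 := by
    rintro π w' t (rfl | rfl)
    · exact lineKey_zsmul_uvec π t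
    · rw [smul_neg, ← neg_smul]; exact lineKey_zsmul_uvec π (-t)
  -- injectivity of the three families
  have hinj1 : Set.InjOn (exit1 hd M) P := by
    intro w hw w' hw' hh
    obtain ⟨x, he, hk⟩ := sp1 w hw
    obtain ⟨x', he', hk'⟩ := sp1 w' hw'
    rw [he, he', Prod.mk.injEq] at hh
    have hπ : perpDir hd w = perpDir hd w' := uvec_injective (by have := hh.2; rw [hh.1] at this; exact add_left_cancel this)
    rw [← hk, ← hk', hπ, hh.1]
  have hinj2 : Set.InjOn (exit2 hd M) P := by
    intro w hw w' hw' hh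
    obtain ⟨x, he, hk⟩ := sp2 w hw
    obtain ⟨x', he', hk'⟩ := sp2 w' hw'
    rw [he, he', Prod.mk.injEq] at hh
    have hπ : perpDir hd w = perpDir hd w' := uvec_injective (by have := hh.2; rw [hh.1] at this; exact sub_right_injective this)
    rw [← hk, ← hk', hπ, hh.1]
  have hinj3 : Set.InjOn (exit3 b hd M) P := by
    intro w hw w' hw' hh
    rcases sp3 w hw with ⟨t, ht, he⟩ | ⟨x, he, hk⟩ <;> rcases sp3 w' hw' with ⟨t', ht', he'⟩ | ⟨x', he', hk'⟩ <;>
      rw [he, he', Prod.mk.injEq] at hh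
    · have := hh.2; rw [hh.1] at this; exact add_left_cancel this
    · exfalso
      have hstep : w = uvec (perpDir hd w') := by have := hh.2; rw [hh.1] at this; exact add_left_cancel this
      have := key3A (perpDir hd w') w t (Or.inl hstep.symm)
      rw [hh.1, hk'] at this
      exact (pf w' hw').1 (by have := congrArg (fun z : Site d => z) this; exact (smul_eq_zero.1 this).resolve_left two_ne_zero)
    · exfalso
      have hstep : uvec (perpDir hd w) = w' := by have := hh.2; rw [hh.1] at this; exact add_left_cancel this
      have := key3A (perpDir hd w) w' t' (Or.inl hstep)
      rw [← hh.1, hk] at this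
      exact (pf w hw).1 ((smul_eq_zero.1 this).resolve_left two_ne_zero)
    · have hπ : perpDir hd w = perpDir hd w' := uvec_injective (by have := hh.2; rw [hh.1] at this; exact add_left_cancel this)
      have : (2 : ℤ) • w = (2 : ℤ) • w' := by rw [← hk, ← hk', hπ, hh.1]
      exact smul_right_injective (Site d) two_ne_zero this
  -- disjointness of the three images
  set F1 := P.image (exit1 hd M) with hF1
  set F2 := P.image (exit2 hd M) with hF2
  set F3 := P.image (exit3 b hd M) with hF3
  have hd12 : Disjoint F1 F2 := by
    rw [disjoint_left]; intro pr h1 h2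
    obtain ⟨w, hw, rfl⟩ := mem_image.1 h1
    obtain ⟨w', hw', hh⟩ := mem_image.1 h2
    obtain ⟨x, he, -⟩ := sp1 w hw
    obtain ⟨x', he', -⟩ := sp2 w' hw'
    rw [he, he', Prod.mk.injEq] at hh
    have : x' - uvec (perpDir hd w') = x' + uvec (perpDir hd w) := by rw [hh.2, hh.1]
    rw [sub_eq_add_neg] at this
    have := add_left_cancel this
    exact uvec_add_uvec_ne_zero (perpDir hd w') (perpDir hd w) (by rw [← this, add_neg_cancel])
  have hd13 : Disjoint F1 F3 := by
    rw [disjoint_left]; intro pr h1 h3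
    obtain ⟨w, hw, rfl⟩ := mem_image.1 h1
    obtain ⟨w', hw', hh⟩ := mem_image.1 h3
    obtain ⟨x, he, hk⟩ := sp1 w hw
    rcases sp3 w' hw' with ⟨t', -, he'⟩ | ⟨x', he', hk'⟩ <;> rw [he, he', Prod.mk.injEq] at hh
    · have hstep : w' = uvec (perpDir hd w) := by have := hh.2; rw [hh.1] at this; exact add_left_cancel this
      have := key3A (perpDir hd w) w' t' (Or.inl hstep.symm)
      rw [hh.1, hk] at this
      exact (pf w hw).1 this
    · have hπ : perpDir hd w' = perpDir hd w := uvec_injective (by have := hh.2; rw [hh.1] at this; exact add_left_cancel this)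
      obtain ⟨j, s, hs, rfl⟩ := (pf w hw).2.2
      obtain ⟨j', s', hs', rfl⟩ := (pf w' hw').2.2
      have : (s • uvec j : Site d) = (2 : ℤ) • (s' • uvec j') := by rw [← hk, ← hk', hπ, hh.1]
      exact petal_ne_two_smul hs hs' this
  have hd23 : Disjoint F2 F3 := by
    rw [disjoint_left]; intro pr h2 h3
    obtain ⟨w, hw, rfl⟩ := mem_image.1 h2
    obtain ⟨w', hw', hh⟩ := mem_image.1 h3
    obtain ⟨x, he, hk⟩ := sp2 w hw
    rcases sp3 w' hw' with ⟨t', -, he'⟩ | ⟨x', he', -⟩ <;> rw [he, he', Prod.mk.injEq] at hh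
    · have hstep : w' = -uvec (perpDir hd w) := by
        have := hh.2; rw [hh.1, sub_eq_add_neg] at this; exact add_left_cancel this
      have := key3A (perpDir hd w) w' t' (Or.inr hstep.symm)
      rw [hh.1, hk] at this
      exact (pf w hw).1 this
    · have : x' + uvec (perpDir hd w') = x' - uvec (perpDir hd w) := by rw [hh.2, hh.1]
      rw [sub_eq_add_neg] at this
      have := add_left_cancel this
      exact uvec_add_uvec_ne_zero (perpDir hd w') (perpDir hd w) (by rw [this, neg_add_cancel])
  -- count
  have hsub : F1 ∪ F2 ∪ F3 ⊆ ffBdryPairs d b M := by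
    intro pr hpr
    rcases mem_union.1 hpr with hpr | hpr
    · rcases mem_union.1 hpr with hpr | hpr
      · obtain ⟨w, hw, rfl⟩ := mem_image.1 hpr
        exact (exits_mem_ffBdryPairs hd hb (hPmem w hw).2 (hPmem w hw).1).1
      · obtain ⟨w, hw, rfl⟩ := mem_image.1 hpr
        exact (exits_mem_ffBdryPairs hd hb (hPmem w hw).2 (hPmem w hw).1).2.1
    · obtain ⟨w, hw, rfl⟩ := mem_image.1 hpr
      exact (exits_mem_ffBdryPairs hd hb (hPmem w hw).2 (hPmem w hw).1).2.2
  calc 3 * #P = #F1 + #F2 + #F3 := by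
        rw [hF1, hF2, hF3, card_image_of_injOn hinj1, card_image_of_injOn hinj2, card_image_of_injOn hinj3]; ring
    _ = #(F1 ∪ F2 ∪ F3) := by
        rw [card_union_of_disjoint (disjoint_union_left.2 ⟨hd13, hd23⟩), card_union_of_disjoint hd12]
    _ ≤ #(ffBdryPairs d b M) := card_le_card hsub

end PetalExits

/-! ### The energy balance, term by term -/

section Terms

variable (b : ℕ) (σ : SpinConfig (Site d)) (S : Finset (Site d)) (L : Finset (Finset (Site d)))

/-- The difference of bond values under the transformation. [cite: FriedliVelenik2017, Lemma 3.36, eq. (3.37)] -/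
def gdiff (q : Site d × Fin d) : ℝ := bondVal (tcfg b σ S L) q - bondVal σ q

/-- **The bonds inside `N`**: the oriented edges touching `S ∪ N` with both endpoints in `N`.
[cite: FriedliVelenik2017, §7.2.6] -/
def inN : Finset (Site d × Fin d) := (oedges (S ∪ minusSet L)).filter fun q => q.1 ∈ minusSet L ∧ q.1 + uvec q.2 ∈ minusSet L

/-- The shiftable internal spin–spin bonds inside `N` (both preimages in `N`). [cite: VanenterFernandezSokal1993, §4.3.2] -/
def Q₁ : Finset (Site d × Fin d) :=
  ((inN S L).filter (SS b)).filter fun q => q.1 - shiftVec d b ∈ minusSet L ∧ q.1 + uvec q.2 - shiftVec d b ∈ minusSet L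

/-- The internal spin–spin bonds inside `N` whose translates lie inside `N`. [cite: VanenterFernandezSokal1993, §4.3.2] -/
def Q₂ : Finset (Site d × Fin d) :=
  ((inN S L).filter (SS b)).filter fun q => q.1 + shiftVec d b ∈ minusSet L ∧ q.1 + uvec q.2 + shiftVec d b ∈ minusSet L

end Terms

namespace CtData

variable {b : ℕ} {p : ℤˣ} {R' r : ℕ} {σ : SpinConfig (Site d)} {S : Finset (Site d)} {L : Finset (Finset (Site d))}
variable (h : CtData d b p R' r σ S L)
include h

/-- Notation within the proofs: `N`. -/
local notation "N" => minusSet L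
/-- Notation within the proofs: `σ'`. -/
local notation "σ'" => tcfg b σ S L
/-- Notation within the proofs: `v`. -/
local notation "v" => shiftVec d b
/-- Notation within the proofs: the bond differences. -/
local notation "g" => gdiff b σ S L
/-- Notation within the proofs: the bonds inside `N`. -/
local notation "EN" => inN S L
/-- Notation within the proofs. -/
local notation "Q1" => Q₁ b S L
/-- Notation within the proofs. -/
local notation "Q2" => Q₂ b S L

/-! #### The energy difference localises to the bonds touching `S ∪ N` -/

/-- **Localisation**: `H(σ) - H(σ') = ∑_{q touching S ∪ N} (bondVal σ' q - bondVal σ q)`.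
[cite: FriedliVelenik2017, Lemma 3.36, eq. (3.37)] -/
theorem hamiltonian_sub_eq :
    isingHamiltonian (zdGraph d) (spacingVolume d b R') 0 (.fixed (ξb d b p R')) σ -
      isingHamiltonian (zdGraph d) (spacingVolume d b R') 0 (.fixed (ξb d b p R')) σ' =
      ∑ q ∈ oedges (S ∪ N), g q := by
  classical
  rw [isingHamiltonian_eq_neg_sum_bondVal, isingHamiltonian_eq_neg_sum_bondVal, neg_sub_neg, ← sum_sub_distrib]
  set D := (S ∪ N).filter (· ∈ spacingVolume d b R') with hD
  have hvan : ∀ q : Site d × Fin d, q.1 ∉ D → q.1 + uvec q.2 ∉ D → g q = 0 := by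
    intro q h1 h2
    have hval : ∀ x, x ∉ D → σ' x = σ x := by
      intro x hx
      rw [hD, mem_filter, not_and_or, mem_union, not_or] at hx
      rcases hx with ⟨hxS, hxN⟩ | hxW
      · exact σ'_of_not_mem hxS hxN
      · exact h.σ'_eq_of_not_mem_W hxW
    simp only [gdiff, bondVal, spinAt, hval _ h1, hval _ h2, sub_self]
  show ∑ q ∈ oedges (spacingVolume d b R'), g q = _
  have hDW : D ⊆ spacingVolume d b R' := fun x hx => (mem_filter.1 hx).2
  rw [sum_oedges_eq_sum_oedges_of_subset hDW g hvan,
    ← sum_oedges_eq_sum_oedges_of_subset (D := D) (A := S ∪ N) (fun q hq => (mem_filter.1 hq).1) g hvan]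

/-! #### Splitting the bonds touching `S ∪ N` -/

omit h in
/-- Membership in `inN`. [folklore] -/
theorem mem_inN {q : Site d × Fin d} : q ∈ EN ↔ q.1 ∈ N ∧ q.1 + uvec q.2 ∈ N := by
  rw [inN, mem_filter]
  exact ⟨fun hq => hq.2, fun hq => ⟨mem_oedges.2 (Or.inl (mem_union_right _ hq.1)), hq⟩⟩

/-- `oedges (S ∪ N) = oedges S ⊔ inN`. [cite: FriedliVelenik2017, §7.2.6] -/
theorem oedges_union_eq : oedges (S ∪ N) = oedges S ∪ EN := by
  ext q
  rw [mem_union, mem_oedges, mem_oedges, mem_inN, mem_union, mem_union]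
  constructor
  · rintro (⟨hq | hq⟩ | ⟨hq | hq⟩)
    · exact Or.inl (Or.inl hq)
    · by_cases h2 : q.1 + uvec q.2 ∈ S
      · exact Or.inl (Or.inr h2)
      · exact Or.inr ⟨hq, h.mem_N_of_adj hq (zdGraph_le_zdStar (zdGraph_adj_add_uvec _ _)) h2⟩
    · exact Or.inl (Or.inr hq)
    · by_cases h1 : q.1 ∈ S
      · exact Or.inl (Or.inl h1)
      · exact Or.inr ⟨h.mem_N_of_adj hq (zdGraph_le_zdStar (zdGraph_adj_add_uvec _ _)).symm h1, hq⟩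
  · rintro ((hq | hq) | ⟨hq, -⟩)
    · exact Or.inl (Or.inl hq)
    · exact Or.inr (Or.inl hq)
    · exact Or.inl (Or.inr hq)

/-- `oedges S` and `inN` are disjoint. [folklore] -/
theorem disjoint_oedges_inN : Disjoint (oedges S) EN := by
  rw [disjoint_left]
  intro q hq hq'
  obtain ⟨h1, h2⟩ := mem_inN.1 hq'
  rcases mem_oedges.1 hq with hS | hS
  · exact (h.not_mem_S_of_mem_N h1).1 hS
  · exact (h.not_mem_S_of_mem_N h2).1 hS

/-- **The split of the energy difference**: bonds touching `S` plus bonds inside `N`.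
[cite: FriedliVelenik2017, §7.2.6] -/
theorem sum_oedges_union_eq : ∑ q ∈ oedges (S ∪ N), g q = ∑ q ∈ oedges S, g q + ∑ q ∈ EN, g q := by
  rw [h.oedges_union_eq, sum_union h.disjoint_oedges_inN]

/-! #### Term A: spin–spin bonds touching `S` -/

/-- **After the transformation, a spin–spin bond touching `S` not involving the origin-in-`N` defect
has value `+1`.** [cite: FriedliVelenik2017, Lemma 3.36 (the erased contour)] -/
theorem bondVal_σ'_eq_one_of_VV {q : Site d × Fin d} (hq : q ∈ oedges S) (hVV : VV b q)
    (hdef : ¬ ((0 : Site d) ∈ N ∧ (q.1 = 0 ∨ q.1 + uvec q.2 = 0))) : bondVal σ' q = 1 := by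
  -- each endpoint becomes `+1`
  have key : ∀ z w : Site d, IsSpin b z → (z ∈ S ∨ w ∈ S) → (zdGraph d).Adj z w → ¬ ((0 : Site d) ∈ N ∧ z = 0) → σ' z = 1 := by
    intro z w hzs hzw hadj hz0
    by_cases hzS : z ∈ S
    · exact σ'_of_mem_S hzs hzS
    have hwS : w ∈ S := hzw.resolve_left hzS
    by_cases hzN : z ∈ N
    · exact h.σ'_eq_one_of_adj_S hzN hzs (fun hz => hz0 ⟨hz ▸ hzN, hz⟩) hwS (zdGraph_le_zdStar hadj)
    · rw [σ'_of_not_mem hzS hzN]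
      exact h.apply_eq_one_of_adj_S hwS (zdGraph_le_zdStar hadj).symm hzS hzN hzs
  have hq' := mem_oedges.1 hq
  have h1 : σ' q.1 = 1 := key q.1 (q.1 + uvec q.2) hVV.1 hq' (zdGraph_adj_add_uvec _ _) (fun hh => hdef ⟨hh.1, Or.inl hh.2⟩)
  have h2 : σ' (q.1 + uvec q.2) = 1 :=
    key (q.1 + uvec q.2) q.1 hVV.2 hq'.symm (zdGraph_adj_add_uvec _ _).symm (fun hh => hdef ⟨hh.1, Or.inr hh.2⟩)
  exact bondVal_of_eq_one h1 h2

/-- **Term A**: over the spin–spin bonds touching `S`, the bond values increase by at least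
`2U - 4d·𝟙[0 ∈ N]`. [cite: FriedliVelenik2017, Lemma 3.36, eq. (3.37)] -/
theorem termA_ge :
    2 * (frusCount b σ S : ℝ) - (if (0 : Site d) ∈ N then 4 * (d : ℝ) else 0) ≤ ∑ q ∈ (oedges S).filter (VV b), g q := by
  classical
  set F := (oedges S).filter (VV b) with hF
  -- the defect predicate
  let dfc : Site d × Fin d → Prop := fun q => (0 : Site d) ∈ N ∧ (q.1 = 0 ∨ q.1 + uvec q.2 = 0)
  have hpt : ∀ q ∈ F, (1 - bondVal σ q) - 2 * (if dfc q then 1 else 0) ≤ g q := by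
    intro q hq
    obtain ⟨hqS, hVV⟩ := mem_filter.1 hq
    by_cases hdef : dfc q
    · rw [if_pos hdef]
      have := neg_one_le_bondVal σ' q
      simp only [gdiff]; linarith
    · rw [if_neg hdef, gdiff, h.bondVal_σ'_eq_one_of_VV hqS hVV hdef]
      linarith
  refine le_trans ?_ (sum_le_sum hpt)
  rw [sum_sub_distrib, ← mul_sum]
  -- the frustration count
  have hfr : ∑ q ∈ F, (1 - bondVal σ q) = 2 * (frusCount b σ S : ℝ) := by
    rw [sum_congr rfl fun q hq => one_sub_bondVal_of_VV (σ := σ) (mem_filter.1 hq).2, ← sum_filter, frusCount]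
    have : F.filter (Frus b σ) = (oedges S).filter (Frus b σ) := by
      ext q; simp only [hF, mem_filter, Frus, and_assoc]; tauto
    rw [this, sum_const, nsmul_eq_mul, mul_comm]
  -- the defect count
  have hdf : ∑ q ∈ F, (if dfc q then (1 : ℝ) else 0) ≤ if (0 : Site d) ∈ N then 2 * (d : ℝ) else 0 := by
    rw [sum_boole]
    by_cases h0 : (0 : Site d) ∈ N
    · rw [if_pos h0]
      have hsub : F.filter dfc ⊆ originEdges d := fun q hq => mem_originEdges (mem_filter.1 hq).2.2
      calc ((#(F.filter dfc) : ℕ) : ℝ) ≤ #(originEdges d) := by exact_mod_cast card_le_card hsub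
        _ ≤ 2 * (d : ℝ) := by exact_mod_cast card_originEdges_le d
    · rw [if_neg h0]
      have : F.filter dfc = ∅ := by
        rw [eq_empty_iff_forall_notMem]; intro q hq; exact h0 (mem_filter.1 hq).2.1
      rw [this, card_empty, Nat.cast_zero]
  rw [hfr]
  split_ifs at hdf ⊢ <;> linarith

/-! #### Term B: spin–spin bonds inside `N` cancel under the symmetry -/

/-- Translation maps `Q₁` to `Q₂`. [cite: VanenterFernandezSokal1993, §4.3.2 (periodicity)] -/
theorem sub_mem_Q₂ {q : Site d × Fin d} (hq : q ∈ Q1) : (q.1 - v, q.2) ∈ Q2 := by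
  obtain ⟨hq, h1, h2⟩ := mem_filter.1 hq
  obtain ⟨hqN, hSS⟩ := mem_filter.1 hq
  obtain ⟨hN1, hN2⟩ := mem_inN.1 hqN
  refine mem_filter.2 ⟨mem_filter.2 ⟨mem_inN.2 ⟨h1, by rwa [sub_add_eq_add_sub]⟩, ?_, ?_⟩, by simpa using hN1, ?_⟩
  · rw [h.shiftVec_eq', isSpImageSite_sub_bvec_iff]; exact hSS.1
  · show ¬ IsSpImageSite d b (q.1 - v + uvec q.2)
    rw [sub_add_eq_add_sub, h.shiftVec_eq', isSpImageSite_sub_bvec_iff]; exact hSS.2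
  · show q.1 - v + uvec q.2 + v ∈ N
    rwa [sub_add_eq_add_sub, sub_add_cancel]

/-- Translation maps `Q₂` to `Q₁`. [cite: VanenterFernandezSokal1993, §4.3.2 (periodicity)] -/
theorem add_mem_Q₁ {q : Site d × Fin d} (hq : q ∈ Q2) : (q.1 + v, q.2) ∈ Q1 := by
  obtain ⟨hq, h1, h2⟩ := mem_filter.1 hq
  obtain ⟨hqN, hSS⟩ := mem_filter.1 hq
  obtain ⟨hN1, hN2⟩ := mem_inN.1 hqN
  refine mem_filter.2 ⟨mem_filter.2 ⟨mem_inN.2 ⟨h1, by rwa [add_right_comm]⟩, ?_, ?_⟩, by simpa using hN1, ?_⟩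
  · rw [h.shiftVec_eq', isSpImageSite_add_bvec_iff]; exact hSS.1
  · show ¬ IsSpImageSite d b (q.1 + v + uvec q.2)
    rw [add_right_comm, h.shiftVec_eq', isSpImageSite_add_bvec_iff]; exact hSS.2
  · show q.1 + v + uvec q.2 - v ∈ N
    rwa [add_right_comm, add_sub_cancel_right]

/-- `#Q₁ = #Q₂`. [folklore] -/
theorem card_Q₁_eq : #Q1 = #Q2 :=
  card_nbij' (fun q => (q.1 - v, q.2)) (fun q => (q.1 + v, q.2)) (fun q hq => h.sub_mem_Q₂ hq) (fun q hq => h.add_mem_Q₁ hq)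
    (fun q _ => by simp) (fun q _ => by simp)

/-- **Covariance of the shiftable bonds**: for `q ∈ Q₁`, `bondVal σ' q = bondVal σ (q - v)`.
[cite: VanenterFernandezSokal1993, §4.3.2 (the symmetry T)] -/
theorem bondVal_σ'_of_mem_Q₁ {q : Site d × Fin d} (hq : q ∈ Q1) : bondVal σ' q = bondVal σ (q.1 - v, q.2) := by
  obtain ⟨hq, h1, h2⟩ := mem_filter.1 hq
  obtain ⟨hqN, hSS⟩ := mem_filter.1 hq
  obtain ⟨hN1, hN2⟩ := mem_inN.1 hqN
  have e1 : σ' q.1 = -σ (q.1 - v) :=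
    newCfg_of_mem_N_of_mem σ (isSpin_of_not_isSpImageSite hSS.1) (h.not_mem_S_of_mem_N hN1).1 hN1 h1
  have e2 : σ' (q.1 + uvec q.2) = -σ (q.1 + uvec q.2 - v) :=
    newCfg_of_mem_N_of_mem σ (isSpin_of_not_isSpImageSite hSS.2) (h.not_mem_S_of_mem_N hN2).1 hN2 h2
  simp only [bondVal, spinAt, e1, e2, Units.val_neg, Int.cast_neg, neg_mul_neg, sub_add_eq_add_sub]

/-- **Left rim**: an internal spin–spin bond inside `N` which is not shiftable has value `+1` after the
transformation. [cite: VanenterFernandezSokal1993, §4.3.2; FriedliVelenik2017, §7.2.6] -/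
theorem bondVal_σ'_of_not_mem_Q₁ {q : Site d × Fin d} (hq : q ∈ (EN).filter (SS b)) (hq1 : q ∉ Q1) : bondVal σ' q = 1 := by
  obtain ⟨hqN, hSS⟩ := mem_filter.1 hq
  obtain ⟨hN1, hN2⟩ := mem_inN.1 hqN
  have hS1 := (h.not_mem_S_of_mem_N hN1).1
  have hS2 := (h.not_mem_S_of_mem_N hN2).1
  have hs1 := isSpin_of_not_isSpImageSite hSS.1
  have hs2 := isSpin_of_not_isSpImageSite hSS.2
  -- generic step: if `x - v ∉ N` then both `x` and its neighbour `w` become `+1`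
  have key : ∀ x w : Site d, x ∈ N → w ∈ N → x ∉ S → w ∉ S → ¬ IsSpImageSite d b x → ¬ IsSpImageSite d b w →
      (zdGraph d).Adj x w → x - v ∉ N → σ' x = 1 ∧ σ' w = 1 := by
    intro x w hxN hwN hxS hwS hxi hwi hadj hxv
    refine ⟨newCfg_of_mem_N_of_not_mem σ (isSpin_of_not_isSpImageSite hxi) hxS hxN hxv, ?_⟩
    by_cases hwv : w - v ∈ N
    · rw [show σ' w = -σ (w - v) from newCfg_of_mem_N_of_mem σ (isSpin_of_not_isSpImageSite hwi) hwS hwN hwv]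
      have hwvs : IsSpin b (w - v) := isSpin_of_not_isSpImageSite (by rw [h.shiftVec_eq', isSpImageSite_sub_bvec_iff]; exact hwi)
      rw [h.apply_eq_neg_one_of_mem_N hwv hwvs hxv (supDist_le_one_of_adj ((zdGraph_adj_sub_right_iff v).2 hadj.symm) |>.trans h.hr1),
        neg_neg]
    · exact newCfg_of_mem_N_of_not_mem σ (isSpin_of_not_isSpImageSite hwi) hwS hwN hwv
  have hnot : ¬ (q.1 - v ∈ N ∧ q.1 + uvec q.2 - v ∈ N) := fun hh => hq1 (mem_filter.2 ⟨hq, hh⟩)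
  rcases not_and_or.1 hnot with h1 | h2
  · obtain ⟨e1, e2⟩ := key _ _ hN1 hN2 hS1 hS2 hSS.1 hSS.2 (zdGraph_adj_add_uvec _ _) h1
    exact bondVal_of_eq_one e1 e2
  · obtain ⟨e2, e1⟩ := key _ _ hN2 hN1 hS2 hS1 hSS.2 hSS.1 (zdGraph_adj_add_uvec _ _).symm h2
    exact bondVal_of_eq_one e1 e2

/-- **Right rim**: an internal spin–spin bond inside `N` whose translate leaves `N` has value `+1` before
the transformation. [cite: FriedliVelenik2017, §7.2.6] -/
theorem bondVal_σ_of_not_mem_Q₂ {q : Site d × Fin d} (hq : q ∈ (EN).filter (SS b)) (hq2 : q ∉ Q2) : bondVal σ q = 1 := by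
  obtain ⟨hqN, hSS⟩ := mem_filter.1 hq
  obtain ⟨hN1, hN2⟩ := mem_inN.1 hqN
  have key : ∀ x w : Site d, x ∈ N → w ∈ N → ¬ IsSpImageSite d b x → ¬ IsSpImageSite d b w → (zdGraph d).Adj x w →
      x + v ∉ N → σ x = -1 ∧ σ w = -1 := by
    intro x w hxN hwN hxi hwi hadj hxv
    refine ⟨h.apply_eq_neg_one_of_mem_N hxN (isSpin_of_not_isSpImageSite hxi) hxv ((supDist_add_shiftVec_le b x).trans h.hbr),
      h.apply_eq_neg_one_of_mem_N hwN (isSpin_of_not_isSpImageSite hwi) hxv ?_⟩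
    have h1 := supDist_le_one_of_adj hadj.symm
    have h2 := supDist_add_shiftVec_le b x
    have := supDist_triangle w x (x + v)
    have := h.hr
    omega
  have hnot : ¬ (q.1 + v ∈ N ∧ q.1 + uvec q.2 + v ∈ N) := fun hh => hq2 (mem_filter.2 ⟨hq, hh⟩)
  rcases not_and_or.1 hnot with h1 | h2
  · obtain ⟨e1, e2⟩ := key _ _ hN1 hN2 hSS.1 hSS.2 (zdGraph_adj_add_uvec _ _) h1
    exact bondVal_of_eq_neg_one e1 e2
  · obtain ⟨e2, e1⟩ := key _ _ hN2 hN1 hSS.2 hSS.1 (zdGraph_adj_add_uvec _ _).symm h2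
    exact bondVal_of_eq_neg_one e1 e2

/-- **The internal spin–spin bonds inside `N` cancel exactly** under the transformation.
[cite: VanenterFernandezSokal1993, §4.3.2 (the two phases are related by the symmetry T)] -/
theorem sum_SS_inN_eq : ∑ q ∈ (EN).filter (SS b), bondVal σ' q = ∑ q ∈ (EN).filter (SS b), bondVal σ q := by
  classical
  have hQ₁ : Q1 ⊆ (EN).filter (SS b) := filter_subset _ _
  have hQ₂ : Q2 ⊆ (EN).filter (SS b) := filter_subset _ _
  -- after: shiftable bonds plus `+1`s
  have hA : ∑ q ∈ (EN).filter (SS b), bondVal σ' q = ∑ q ∈ Q2, bondVal σ q + (#((EN).filter (SS b)) - #Q1 : ℝ) := by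
    rw [← sum_sdiff hQ₁, add_comm]
    congr 1
    · refine sum_nbij' (fun q => (q.1 - v, q.2)) (fun q => (q.1 + v, q.2)) (fun q hq => h.sub_mem_Q₂ hq)
        (fun q hq => h.add_mem_Q₁ hq) (fun q _ => by simp) (fun q _ => by simp) (fun q hq => h.bondVal_σ'_of_mem_Q₁ hq)
    · rw [sum_congr rfl fun q hq => h.bondVal_σ'_of_not_mem_Q₁ (mem_sdiff.1 hq).1 (mem_sdiff.1 hq).2, sum_const, nsmul_eq_mul,
        mul_one, card_sdiff_of_subset hQ₁, Nat.cast_sub (card_le_card hQ₁)]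
  have hB : ∑ q ∈ (EN).filter (SS b), bondVal σ q = ∑ q ∈ Q2, bondVal σ q + (#((EN).filter (SS b)) - #Q2 : ℝ) := by
    rw [← sum_sdiff hQ₂, add_comm]
    congr 1
    rw [sum_congr rfl fun q hq => h.bondVal_σ_of_not_mem_Q₂ (mem_sdiff.1 hq).1 (mem_sdiff.1 hq).2, sum_const, nsmul_eq_mul,
      mul_one, card_sdiff_of_subset hQ₂, Nat.cast_sub (card_le_card hQ₂)]
  rw [hA, hB, h.card_Q₁_eq]

/-- **Term B**: over the spin–spin bonds inside `N`, the bond values change by at least `-4d·𝟙[0 ∈ N]`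
(exact cancellation of the internal bonds; the at most `2d` origin bonds are bounded trivially).
[cite: VanenterFernandezSokal1993, §4.3.2] -/
theorem termB_ge : -(if (0 : Site d) ∈ N then 4 * (d : ℝ) else 0) ≤ ∑ q ∈ (EN).filter (VV b), g q := by
  classical
  -- split `VV = SS ⊔ origin bonds`
  have hsplit : (EN).filter (VV b) = (EN).filter (SS b) ∪ ((EN).filter (VV b)).filter (fun q => ¬ SS b q) := by
    ext q
    simp only [mem_union, mem_filter]
    constructor
    · rintro ⟨hq, hv⟩
      by_cases hs : SS b q
      · exact Or.inl ⟨hq, hs⟩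
      · exact Or.inr ⟨⟨hq, hv⟩, hs⟩
    · rintro (⟨hq, hs⟩ | ⟨⟨hq, hv⟩, -⟩)
      · exact ⟨hq, VV_of_SS hs⟩
      · exact ⟨hq, hv⟩
  have hdisj : Disjoint ((EN).filter (SS b)) (((EN).filter (VV b)).filter (fun q => ¬ SS b q)) := by
    rw [disjoint_left]; intro q hq hq'; exact (mem_filter.1 hq').2 (mem_filter.1 hq).2
  rw [hsplit, sum_union hdisj]
  have h0 : ∑ q ∈ (EN).filter (SS b), g q = 0 := by
    simp only [gdiff, sum_sub_distrib, h.sum_SS_inN_eq, sub_self]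
  rw [h0, zero_add]
  -- the origin bonds inside `N`
  set O := ((EN).filter (VV b)).filter (fun q => ¬ SS b q) with hO
  have hOsub : O ⊆ originEdges d := fun q hq => by
    obtain ⟨hq, hs⟩ := mem_filter.1 hq
    exact mem_originEdges ((SS_or_of_VV (mem_filter.1 hq).2).resolve_left hs)
  by_cases h0N : (0 : Site d) ∈ N
  · rw [if_pos h0N]
    calc -(4 * (d : ℝ)) ≤ ∑ q ∈ O, (-2 : ℝ) := by
          rw [sum_const, nsmul_eq_mul]
          have : (#O : ℝ) ≤ 2 * d := by exact_mod_cast (card_le_card hOsub).trans (card_originEdges_le d)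
          nlinarith
      _ ≤ ∑ q ∈ O, g q := sum_le_sum fun q _ => by
          have := neg_one_le_bondVal σ' q; have := bondVal_le_one σ q; simp only [gdiff]; linarith
  · rw [if_neg h0N, neg_zero]
    have hOe : O = ∅ := by
      rw [eq_empty_iff_forall_notMem]
      intro q hq
      obtain ⟨hq, hs⟩ := mem_filter.1 hq
      obtain ⟨hqN, hv⟩ := mem_filter.1 hq
      obtain ⟨hN1, hN2⟩ := mem_inN.1 hqN
      rcases (SS_or_of_VV hv).resolve_left hs with e | e
      · exact h0N (e ▸ hN1)
      · exact h0N (e ▸ hN2)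
    rw [hOe, sum_empty]

/-! #### Term C: the image–spin bonds, as a sum over spin sites -/

/-- Notation within the proofs: the genuine image field of `ξ_p`. -/
local notation "hf" => gField b (ξb d b p R')
/-- Notation within the proofs: the spin sites of `N`. -/
local notation "N0" => Finset.filter (IsSpin b) (minusSet L)

/-- Genuine image sites are not in `W(R')`, so their spins are frozen to `ξ_p`. [cite: VanenterFernandezSokal1993, §4.2 Step 2] -/
theorem apply_of_isGImg {a : Site d} (ha : IsGImg b a) : σ a = ξb d b p R' a :=
  h.cfg a fun haW => (isSpin_iff_not_isGImg.1 (isSpin_of_mem_spacingVolume haW)) ha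

/-- **Term C as a site sum**: over the image–spin bonds touching `S ∪ N`, the change of bond values is
`∑_{z ∈ (S ∪ N) spin} (σ'_z - σ_z) h'_z`. [cite: VanenterFernandezSokal1993, App. B.5.3 eq. (B.71) (ΔE₋ - ΔE₊)] -/
theorem termC_eq : ∑ q ∈ (oedges (S ∪ N)).filter (fun q => ¬ VV b q), g q =
    ∑ z ∈ (S ∪ N).filter (IsSpin b), (spinAt z σ' - spinAt z σ) * hf z := by
  have hF : ∀ z a : Site d, z ∉ S ∪ N → spinAt a (ξb d b p R') * (spinAt z σ' - spinAt z σ) = 0 := by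
    intro z a hz
    rw [mem_union, not_or] at hz
    simp only [spinAt, σ'_of_not_mem hz.1 hz.2, sub_self, mul_zero]
  rw [sum_filter_not_VV_eq h.hb2 (S ∪ N) (fun z a => spinAt a (ξb d b p R') * (spinAt z σ' - spinAt z σ)) g ?_ hF]
  · refine sum_congr rfl fun z _ => ?_
    rw [gField, mul_sum]
    exact sum_congr rfl fun a _ => by ring
  · intro q hq
    obtain ⟨-, hq⟩ := mem_filter.1 hq
    obtain ⟨-, himg, -, -⟩ := spnEnd_imgEnd_spec h.hb2 hq
    have e1 : σ' (imgEnd b q) = σ (imgEnd b q) := σ'_of_isGImg himg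
    have e2 : σ (imgEnd b q) = ξb d b p R' (imgEnd b q) := h.apply_of_isGImg himg
    simp only [gdiff, bondVal, spnEnd, imgEnd, spinAt] at e1 e2 ⊢
    by_cases hs : IsSpin b q.1
    · rw [if_pos hs] at e1 e2; simp only [if_pos hs, e1, e2]; ring
    · rw [if_neg hs] at e1 e2; simp only [if_neg hs, e1, e2]; ring

omit h in
/-- **Term C, the part on `S`**: `∑_{z ∈ S spin} (σ'_z - σ_z) h'_z = 2 ∑_{z ∈ S⁻} h'_z`, where `S⁻` is the
set of spin sites of `S` carrying `-1`. [cite: VanenterFernandezSokal1993, App. B.5.3 eq. (B.71)] -/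
theorem termC_S_eq : ∑ z ∈ S.filter (IsSpin b), (spinAt z σ' - spinAt z σ) * hf z =
    2 * ∑ z ∈ (S.filter (IsSpin b)).filter (fun z => σ z = -1), hf z := by
  rw [mul_sum, sum_filter (fun z => σ z = -1)]
  refine sum_congr rfl fun z hz => ?_
  obtain ⟨hzS, hzs⟩ := mem_filter.1 hz
  rw [spinAt, spinAt, σ'_of_mem_S hzs hzS]
  rcases Int.units_eq_one_or (σ z) with h1 | h1
  · rw [if_neg (by rw [h1]; decide), h1]; simp
  · rw [if_pos h1, h1]; push_cast; ring

/-! #### Term C on `N`: telescoping under the symmetry -/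

/-- `v e₀ = b`. [folklore] -/
theorem shiftVec_apply_i₀ : (v) h.i₀ = b := by simp [shiftVec, CtData.i₀]

/-- `v j = 0` for `j ≠ e₀`. [folklore] -/
theorem shiftVec_apply_of_ne {j : Fin d} (hj : j ≠ h.i₀) : (v) j = 0 := by
  simp only [shiftVec]
  rw [if_neg]
  exact fun h0 => hj (Fin.ext h0)

omit h in
/-- `-v` is an image site. [folklore] -/
theorem isSpImageSite_neg_shiftVec : IsSpImageSite d b (-(v)) := by
  intro i; simp only [Pi.neg_apply, shiftVec]; split_ifs <;> simp

/-- `v ≠ 0`. [folklore] -/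
theorem shiftVec_ne_zero : (v) ≠ 0 := by
  rw [h.shiftVec_eq']; exact bvec_ne_zero (le_trans (by norm_num) h.hb) _

/-- `ξ_p(-v) = -p`. [cite: VanenterFernandezSokal1993, eq. (4.2)] -/
theorem ξb_neg_shiftVec (hR' : 1 ≤ R') : ξb d b p R' (-(v)) = -p := by
  have h0 : ((fun j => (0 : Site d) j / (b : ℤ)) : Site d) = 0 := funext fun j => by simp
  have := ξb_sub_bvec' (d := d) (p := p) (R' := R') h.hb0 h.i₀ (isSpImageSite_zero b) (by rw [h0]; exact zero_mem_box d R')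
    (by rw [h0, mem_box]; intro i; simp only [Pi.sub_apply, Pi.zero_apply, uvec_apply]; split_ifs <;> omega)
  rw [zero_sub, ← h.shiftVec_eq', ξb_zero h.hb0] at this
  exact this

/-- A site of `N` forces `R' ≥ 1`. [folklore] -/
theorem one_le_R' {u : Site d} (hu : u ∈ N) : 1 ≤ R' := by
  have h1 := h.natAbs_add_le_of_mem_N hu h.i₀
  have h2 := h.hr1
  rcases Nat.eq_zero_or_pos R' with h0 | hpos
  · exfalso; subst h0; simp only [Nat.cast_zero, mul_zero] at h1; omega
  · exact hpos

/-- **Image neighbours of sites deep inside the box stay in the alternating zone, even after the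
shift.** [cite: VanenterFernandezSokal1993, §4.3.1 Step 2] -/
theorem quot_mem_box_of_adj {z a : Site d} (hz : ∀ i, ((z i).natAbs : ℤ) + b + 1 ≤ b * R') (hadj : (zdGraph d).Adj z a)
    (ha : IsSpImageSite d b a) :
    (fun j => a j / (b : ℤ)) ∈ box d R' ∧ (fun j => (a + v) j / (b : ℤ)) ∈ box d R' ∧
      (fun j => (a + v) j / (b : ℤ)) - uvec h.i₀ = (fun j => a j / (b : ℤ)) := by
  have hb0 := h.hb0
  have hb' : (b : ℤ) ≠ 0 := by exact_mod_cast hb0.ne'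
  have hcoord : ∀ j, ((a j).natAbs : ℤ) ≤ (z j).natAbs + 1 := fun j => by
    have := natAbs_sub_le_supDist a z j
    have := supDist_le_one_of_adj hadj.symm
    omega
  have hav : IsSpImageSite d b (a + v) := by rw [h.shiftVec_eq', isSpImageSite_add_bvec_iff]; exact ha
  refine ⟨ediv_mem_box_of_mem_box hb0 ha (mem_box.2 fun j => ?_), ediv_mem_box_of_mem_box hb0 hav (mem_box.2 fun j => ?_), ?_⟩
  · have := hz j; have := hcoord j; push_cast; omega
  · have h1 := hz j; have h2 := hcoord j
    rw [Pi.add_apply]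
    by_cases hj : j = h.i₀
    · subst hj; rw [h.shiftVec_apply_i₀]; push_cast; omega
    · rw [h.shiftVec_apply_of_ne hj, add_zero]; push_cast; omega
  · funext j
    rw [Pi.sub_apply, Pi.add_apply, uvec_apply]
    by_cases hj : j = h.i₀
    · rw [if_pos hj, hj, h.shiftVec_apply_i₀, show a h.i₀ + (b : ℤ) = a h.i₀ + 1 * b by ring, Int.add_mul_ediv_right _ _ hb']
      ring
    · rw [if_neg hj, h.shiftVec_apply_of_ne hj, add_zero, sub_zero]

/-- **`T`-covariance of the frozen image spins next to a deep site**: `ξ_p(a + v) = -ξ_p(a)` for an image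
neighbour `a` of a site `z` with `|z i| + b + 1 ≤ b R'`. [cite: VanenterFernandezSokal1993, eq. (4.2) and §4.3.2] -/
theorem ξb_add_shiftVec {z a : Site d} (hz : ∀ i, ((z i).natAbs : ℤ) + b + 1 ≤ b * R') (hadj : (zdGraph d).Adj z a)
    (ha : IsSpImageSite d b a) : ξb d b p R' (a + v) = -ξb d b p R' a := by
  obtain ⟨h1, h2, h3⟩ := h.quot_mem_box_of_adj hz hadj ha
  have hav : IsSpImageSite d b (a + v) := by rw [h.shiftVec_eq', isSpImageSite_add_bvec_iff]; exact ha
  have := ξb_sub_bvec' (d := d) (p := p) (R' := R') h.hb0 h.i₀ hav h2 (by rw [h3]; exact h1)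
  rw [← h.shiftVec_eq', add_sub_cancel_right] at this
  rw [← neg_neg (ξb d b p R' (a + v)), ← this]

omit h in
/-- The sum of `f` over a finset with one point removed. [folklore] -/
theorem sum_filter_ne_eq {s : Finset (Site d)} (f : Site d → ℝ) (c : Site d) :
    ∑ a ∈ s.filter (fun a => a ≠ c), f a = ∑ a ∈ s, f a - if c ∈ s then f c else 0 := by
  classical
  rw [← sum_filter_add_sum_filter_not s (fun a => a ≠ c)]
  have : ∑ a ∈ s.filter (fun a => ¬ a ≠ c), f a = if c ∈ s then f c else 0 := by
    have hs : s.filter (fun a => ¬ a ≠ c) = s.filter (fun a => a = c) := filter_congr fun a _ => by simp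
    rw [hs]
    split_ifs with hc
    · rw [filter_eq' s c, if_pos hc, sum_singleton]
    · rw [filter_eq' s c, if_neg hc, sum_empty]
  rw [this]; ring

/-- Notation within the proofs: the petals (nearest neighbours) of a site. -/
local notation "pet" => SimpleGraph.neighborFinset (zdGraph d)

/-- **Covariance of the genuine image field**: for a spin site `z` deep inside the box,
`h'(z + v) + h'(z) = -p·(𝟙[z ∼ -v] + 𝟙[z ∼ 0])` — the fields of `T`-related sites are opposite, except
for the missing contributions of the origin (a spin, not an image) and of its `T`-preimage `-v`.
[cite: VanenterFernandezSokal1993, §4.3.2 (periodicity of the field)] -/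
theorem gField_add_shiftVec {z : Site d} (hz : ∀ i, ((z i).natAbs : ℤ) + b + 1 ≤ b * R') (hR' : 1 ≤ R') :
    hf (z + v) + hf z = -((p : ℤ) : ℝ) * ((if z ∈ pet (-(v)) then 1 else 0) + (if z ∈ pet 0 then 1 else 0)) := by
  classical
  -- `h'(z+v)` as a sum over the image neighbours of `z` other than `-v`
  have h1 : hf (z + v) = -∑ a ∈ (imgNbrs d b z).filter (fun a => a ≠ -(v)), spinAt a (ξb d b p R') := by
    rw [gField, ← sum_neg_distrib]
    symm
    refine sum_nbij' (fun a => a + v) (fun a => a - v) (fun a ha => ?_) (fun a ha => ?_) (fun a _ => by simp) (fun a _ => by simp)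
      (fun a ha => ?_)
    · obtain ⟨ha, hne⟩ := mem_filter.1 (mem_coe.1 ha)
      obtain ⟨hadj, himg⟩ := mem_imgNbrs.1 ha
      refine mem_coe.2 (mem_gimgNbrs.2 ⟨(zdGraph_adj_add_right_iff (v)).2 hadj, ?_, fun h0 => hne ?_⟩)
      · rw [h.shiftVec_eq', isSpImageSite_add_bvec_iff]; exact himg
      · exact eq_neg_of_add_eq_zero_left h0
    · obtain ⟨hadj, himg, hne⟩ := mem_gimgNbrs.1 (mem_coe.1 ha)
      refine mem_coe.2 (mem_filter.2 ⟨mem_imgNbrs.2 ⟨?_, ?_⟩, fun h0 => hne ?_⟩)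
      · have := (zdGraph_adj_sub_right_iff (v)).2 hadj; rwa [add_sub_cancel_right] at this
      · rw [h.shiftVec_eq', isSpImageSite_sub_bvec_iff]; exact himg
      · have := congrArg (· + v) h0; simpa using this
    · obtain ⟨ha, -⟩ := mem_filter.1 (mem_coe.1 ha)
      obtain ⟨hadj, himg⟩ := mem_imgNbrs.1 ha
      rw [spinAt, spinAt, h.ξb_add_shiftVec hz hadj himg, Units.val_neg, Int.cast_neg]
  -- `h'(z)` as a sum over the image neighbours of `z` other than `0`
  have h2 : hf z = ∑ a ∈ (imgNbrs d b z).filter (fun a => a ≠ 0), spinAt a (ξb d b p R') := by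
    rw [gField]
    refine sum_congr ?_ fun _ _ => rfl
    ext a; rw [mem_gimgNbrs, mem_filter, mem_imgNbrs, IsGImg, and_assoc]
  rw [h1, h2, sum_filter_ne_eq, sum_filter_ne_eq]
  have hm1 : -(v) ∈ imgNbrs d b z ↔ z ∈ pet (-(v)) := by
    rw [mem_imgNbrs, SimpleGraph.mem_neighborFinset]
    exact ⟨fun hh => hh.1.symm, fun hh => ⟨hh.symm, isSpImageSite_neg_shiftVec⟩⟩
  have hm2 : (0 : Site d) ∈ imgNbrs d b z ↔ z ∈ pet 0 := by
    rw [mem_imgNbrs, SimpleGraph.mem_neighborFinset]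
    exact ⟨fun hh => hh.1.symm, fun hh => ⟨hh.symm, isSpImageSite_zero b⟩⟩
  have hv1 : spinAt (-(v)) (ξb d b p R') = -((p : ℤ) : ℝ) := by
    rw [spinAt, h.ξb_neg_shiftVec hR', Units.val_neg, Int.cast_neg]
  have hv2 : spinAt (0 : Site d) (ξb d b p R') = ((p : ℤ) : ℝ) := by rw [spinAt, ξb_zero h.hb0]
  by_cases c1 : z ∈ pet (-(v)) <;> by_cases c2 : z ∈ pet 0
  · rw [if_pos (hm1.2 c1), if_pos (hm2.2 c2), if_pos c1, if_pos c2, hv1, hv2]; ring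
  · rw [if_pos (hm1.2 c1), if_neg (fun hh => c2 (hm2.1 hh)), if_pos c1, if_neg c2, hv1]; ring
  · rw [if_neg (fun hh => c1 (hm1.1 hh)), if_pos (hm2.2 c2), if_neg c1, if_pos c2, hv2]; ring
  · rw [if_neg (fun hh => c1 (hm1.1 hh)), if_neg (fun hh => c2 (hm2.1 hh)), if_neg c1, if_neg c2]; ring

/-- `h'(0) = 0`: the neighbours of the origin are spin sites. [cite: VanenterFernandezSokal1993, §4.1.2 Step 3] -/
theorem gField_zero : hf (0 : Site d) = 0 := by
  rw [gField]
  refine sum_eq_zero fun a ha => ?_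
  obtain ⟨hadj, himg⟩ := mem_gimgNbrs.1 ha
  exact absurd himg.1 (not_isSpImageSite_of_adj_zero h.hb2 hadj)

/-- Sites of `N` are deep: `|z i| + b + 1 ≤ b R'`. [cite: VanenterFernandezSokal1993, §4.3.1 Step 2] -/
theorem deep_of_mem_N {z : Site d} (hz : z ∈ N) (i : Fin d) : ((z i).natAbs : ℤ) + b + 1 ≤ b * R' := by
  have := h.natAbs_add_le_of_mem_N hz i
  have := h.hr
  push_cast at *
  omega

/-- **Term C on `N` (telescoping)**: `∑_{z ∈ N spin} (σ'_z - σ_z) h'_z ≥ 2 ∑_{z ∈ N spin} h'_z - 4·#(N ∩ (petals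
of 0 and of -v))`. The values of `σ'` on `N` are the shifted values `-σ_{z-v}` (bulk) or `+1` (left rim),
the right rim of `σ` is `-1`, and the fields of shifted sites are opposite up to the origin defect.
[cite: VanenterFernandezSokal1993, §4.3.2 and App. B.5.3 eq. (B.71)] -/
theorem termC_N_ge :
    2 * ∑ z ∈ N0, hf z - 4 * (#((minusSet L) ∩ (pet 0 ∪ pet (-(v)))) : ℝ) ≤
      ∑ z ∈ N0, (spinAt z σ' - spinAt z σ) * hf z := by
  classical
  -- abbreviations
  set σr : Site d → ℝ := fun z => spinAt z σ with hσr
  set corr : Site d → ℝ := fun z => -((p : ℤ) : ℝ) * ((if z ∈ pet (-(v)) then 1 else 0) + (if z ∈ pet 0 then 1 else 0))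
    with hcorr
  set Z1 := ((N0).filter (fun z => z ≠ 0)).filter (fun z => z + v ∈ N) with hZ1
  set Y1 := ((N0).filter (fun z => z ≠ 0)).filter (fun z => z - v ∈ N) with hY1
  -- basic facts on `N0`
  have hN0 : ∀ z ∈ N0, z ∈ N ∧ IsSpin b z ∧ z ∉ S := fun z hz =>
    ⟨(mem_filter.1 hz).1, (mem_filter.1 hz).2, (h.not_mem_S_of_mem_N (mem_filter.1 hz).1).1⟩
  -- the bijection `z ↦ z + v : Z1 → Y1`
  have hZY : ∀ z ∈ Z1, z + v ∈ Y1 := by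
    intro z hz
    obtain ⟨hz, hzv⟩ := mem_filter.1 hz
    obtain ⟨hz, hz0⟩ := mem_filter.1 hz
    obtain ⟨hzN, hzs, -⟩ := hN0 z hz
    have hzi : ¬ IsSpImageSite d b z := not_isSpImageSite_of_isSpin hzs hz0
    refine mem_filter.2 ⟨mem_filter.2 ⟨mem_filter.2 ⟨hzv, isSpin_of_not_isSpImageSite ?_⟩, fun h0 => ?_⟩, by simpa using hzN⟩
    · rw [h.shiftVec_eq', isSpImageSite_add_bvec_iff]; exact hzi
    · apply hzi; rw [eq_neg_of_add_eq_zero_left h0]; exact isSpImageSite_neg_shiftVec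
  have hYZ : ∀ y ∈ Y1, y - v ∈ Z1 := by
    intro y hy
    obtain ⟨hy, hyv⟩ := mem_filter.1 hy
    obtain ⟨hy, hy0⟩ := mem_filter.1 hy
    obtain ⟨hyN, hys, -⟩ := hN0 y hy
    have hyi : ¬ IsSpImageSite d b y := not_isSpImageSite_of_isSpin hys hy0
    refine mem_filter.2 ⟨mem_filter.2 ⟨mem_filter.2 ⟨hyv, isSpin_of_not_isSpImageSite ?_⟩, fun h0 => ?_⟩, by simpa using hyN⟩
    · rw [h.shiftVec_eq', isSpImageSite_sub_bvec_iff]; exact hyi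
    · apply hyi; rw [sub_eq_zero.1 h0, h.shiftVec_eq']
      have := (isSpImageSite_add_bvec_iff (b := b) h.i₀ (y := (0 : Site d))).2 (isSpImageSite_zero b)
      rwa [zero_add] at this
  -- covariance of the field on `Z1`
  have hcov : ∀ z ∈ Z1, hf (z + v) = -hf z + corr z := by
    intro z hz
    obtain ⟨hz, -⟩ := mem_filter.1 hz
    obtain ⟨hz, -⟩ := mem_filter.1 hz
    have hzN := (hN0 z hz).1
    have := h.gField_add_shiftVec (h.deep_of_mem_N hzN) (h.one_le_R' hzN)
    rw [hcorr]; linarith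
  -- the `0`-terms vanish
  have hf0 : hf (0 : Site d) = 0 := h.gField_zero
  -- (f1) the sum of `σ' · h'` over `N0`
  have hA : ∑ z ∈ N0, spinAt z σ' * hf z =
      ∑ z ∈ (N0).filter (fun z => z - v ∈ N), (-σr (z - v)) * hf z + ∑ z ∈ (N0).filter (fun z => z - v ∉ N), hf z := by
    rw [← sum_filter_add_sum_filter_not (N0) (fun z => z - v ∈ N)]
    congr 1
    · refine sum_congr rfl fun z hz => ?_
      obtain ⟨hz, hzv⟩ := mem_filter.1 hz
      obtain ⟨hzN, hzs, hzS⟩ := hN0 z hz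
      rw [spinAt, tcfg, newCfg_of_mem_N_of_mem σ hzs hzS hzN hzv, Units.val_neg, Int.cast_neg]
      rfl
    · refine sum_congr rfl fun z hz => ?_
      obtain ⟨hz, hzv⟩ := mem_filter.1 hz
      obtain ⟨hzN, hzs, hzS⟩ := hN0 z hz
      rw [spinAt, tcfg, newCfg_of_mem_N_of_not_mem σ hzs hzS hzN hzv]; simp
  -- (f2)+(f3)+(f4): the shifted part
  have hP : ∀ F : Site d → ℝ, F 0 = 0 →
      ∑ z ∈ (N0).filter (fun z => z - v ∈ N), F z = ∑ y ∈ Y1, F y := by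
    intro F hF0
    rw [← sum_filter_add_sum_filter_not ((N0).filter (fun z => z - v ∈ N)) (fun z => z ≠ 0)]
    have hzero : ∑ z ∈ ((N0).filter (fun z => z - v ∈ N)).filter (fun z => ¬ z ≠ 0), F z = 0 :=
      sum_eq_zero fun z hz => by
        have : z = 0 := by have := (mem_filter.1 hz).2; push Not at this; exact this
        rw [this, hF0]
    rw [hzero, add_zero]
    refine sum_congr ?_ fun _ _ => rfl
    ext z; simp only [hY1, mem_filter]; tauto
  have hR : ∀ F : Site d → ℝ, F 0 = 0 →
      ∑ z ∈ (N0).filter (fun z => z + v ∈ N), F z = ∑ z ∈ Z1, F z := by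
    intro F hF0
    rw [← sum_filter_add_sum_filter_not ((N0).filter (fun z => z + v ∈ N)) (fun z => z ≠ 0)]
    have hzero : ∑ z ∈ ((N0).filter (fun z => z + v ∈ N)).filter (fun z => ¬ z ≠ 0), F z = 0 :=
      sum_eq_zero fun z hz => by
        have : z = 0 := by have := (mem_filter.1 hz).2; push Not at this; exact this
        rw [this, hF0]
    rw [hzero, add_zero]
    refine sum_congr ?_ fun _ _ => rfl
    ext z; simp only [hZ1, mem_filter]; tauto
  have hshift : ∀ F : Site d → ℝ, ∑ y ∈ Y1, F (y - v) * hf y = ∑ z ∈ Z1, F z * hf (z + v) := by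
    intro F
    symm
    exact sum_nbij' (fun z => z + v) (fun y => y - v) hZY hYZ (fun z _ => by simp) (fun y _ => by simp) (fun z _ => by simp)
  -- (f5) the rim values of `σ`
  have hrim : ∀ z ∈ (N0).filter (fun z => z + v ∉ N), σr z = -1 := by
    intro z hz
    obtain ⟨hz, hzv⟩ := mem_filter.1 hz
    obtain ⟨hzN, hzs, -⟩ := hN0 z hz
    simp only [hσr, spinAt, h.apply_eq_neg_one_of_mem_N hzN hzs hzv ((supDist_add_shiftVec_le b z).trans h.hbr), Units.val_neg,
      Units.val_one, Int.cast_neg, Int.cast_one]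
  -- assemble: A = the new field energy, B = the old one
  have hA' : ∑ z ∈ N0, spinAt z σ' * hf z =
      (∑ z ∈ Z1, σr z * hf z - ∑ z ∈ Z1, σr z * corr z) + ∑ z ∈ (N0).filter (fun z => z - v ∉ N), hf z := by
    rw [hA, hP (fun z => (-σr (z - v)) * hf z) (by simp [hf0]), hshift (fun w => -σr w)]
    congr 1
    rw [← sum_sub_distrib]
    refine sum_congr rfl fun z hz => ?_
    rw [hcov z hz]; ring
  have hB' : ∑ z ∈ N0, spinAt z σ * hf z = ∑ z ∈ Z1, σr z * hf z - ∑ z ∈ (N0).filter (fun z => z + v ∉ N), hf z := by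
    rw [← sum_filter_add_sum_filter_not (N0) (fun z => z + v ∈ N), hR (fun z => spinAt z σ * hf z) (by simp [hf0])]
    rw [sub_eq_add_neg, ← sum_neg_distrib]
    congr 1
    exact sum_congr rfl fun z hz => by rw [show spinAt z σ = σr z from rfl, hrim z hz]; ring
  have hH1 : ∑ z ∈ N0, hf z = (-∑ z ∈ Z1, hf z + ∑ z ∈ Z1, corr z) + ∑ z ∈ (N0).filter (fun z => z - v ∉ N), hf z := by
    rw [← sum_filter_add_sum_filter_not (N0) (fun z => z - v ∈ N), hP (fun z => hf z) hf0]
    congr 1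
    have := hshift (fun _ => (1 : ℝ))
    simp only [one_mul] at this
    rw [this, ← sum_neg_distrib, ← sum_add_distrib]
    exact sum_congr rfl fun z hz => by rw [hcov z hz]
  have hH2 : ∑ z ∈ N0, hf z = ∑ z ∈ Z1, hf z + ∑ z ∈ (N0).filter (fun z => z + v ∉ N), hf z := by
    rw [← sum_filter_add_sum_filter_not (N0) (fun z => z + v ∈ N), hR (fun z => hf z) hf0]
  -- the defect term
  have hdef : -(4 * (#((minusSet L) ∩ (pet 0 ∪ pet (-(v)))) : ℝ)) ≤ -∑ z ∈ Z1, σr z * corr z - ∑ z ∈ Z1, corr z := by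
    have hpt : ∀ z ∈ Z1, σr z * corr z + corr z ≤ 4 * (if z ∈ pet 0 ∪ pet (-(v)) then 1 else 0) := by
      intro z _
      have hs : σr z = 1 ∨ σr z = -1 := spinAt_eq_one_or_eq_neg_one z σ
      have hp : ((p : ℤ) : ℝ) = 1 ∨ ((p : ℤ) : ℝ) = -1 := by
        rcases Int.units_eq_one_or p with hp | hp <;> simp [hp]
      rw [hcorr]; simp only [mem_union]
      rcases hs with hs | hs <;> rcases hp with hp | hp <;> rw [hs, hp] <;>
        by_cases c1 : z ∈ pet (-(v)) <;> by_cases c2 : z ∈ pet 0 <;> simp [c1, c2] <;> norm_num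
    have hsum : ∑ z ∈ Z1, (σr z * corr z + corr z) ≤ ∑ z ∈ Z1, 4 * (if z ∈ pet 0 ∪ pet (-(v)) then (1 : ℝ) else 0) :=
      sum_le_sum hpt
    rw [sum_add_distrib] at hsum
    have hcnt : ∑ z ∈ Z1, 4 * (if z ∈ pet 0 ∪ pet (-(v)) then (1 : ℝ) else 0) ≤ 4 * #((minusSet L) ∩ (pet 0 ∪ pet (-(v)))) := by
      rw [← mul_sum, sum_boole]
      gcongr
      intro z hz
      obtain ⟨hz, hzp⟩ := mem_filter.1 hz
      exact mem_inter.2 ⟨(hN0 z (mem_filter.1 (mem_filter.1 hz).1).1).1, hzp⟩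
    linarith
  simp only [sub_mul, sum_sub_distrib]
  rw [hA', hB']
  linarith [hH1, hH2, hdef]

/-! #### The energy balance -/

/-- Notation within the proofs: the `-` spin sites of `S`. -/
local notation "Sm" => Finset.filter (fun z => σ z = -1) (Finset.filter (IsSpin b) S)
/-- Notation within the proofs: the set `M = S⁻ ∪ (N ∩ spin sites)` of the Peierls condition. -/
local notation "M" => (Sm ∪ N0)
/-- Notation within the proofs: the Hamiltonian of the system. -/
local notation "Hm" => isingHamiltonian (zdGraph d) (spacingVolume d b R') 0 (BoundaryCondition.fixed (ξb d b p R'))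

/-- `S⁻` and `N ∩ spin sites` are disjoint. [folklore] -/
theorem disjoint_Sm_N0 : Disjoint (Sm) (N0) := by
  rw [disjoint_left]
  intro z hz hz'
  exact (h.not_mem_S_of_mem_N (mem_filter.1 hz').1).1 (mem_filter.1 (mem_filter.1 hz).1).1

omit h in
/-- Members of `M`. [folklore] -/
theorem mem_M_iff {u : Site d} : u ∈ M ↔ (u ∈ S ∧ IsSpin b u ∧ σ u = -1) ∨ (u ∈ N ∧ IsSpin b u) := by
  simp only [mem_union, mem_filter, and_assoc]

omit h in
/-- Sites of `M` are spin sites. [folklore] -/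
theorem isSpin_of_mem_M {u : Site d} (hu : u ∈ M) : IsSpin b u := by
  rcases mem_M_iff.1 hu with ⟨-, hus, -⟩ | ⟨-, hus⟩ <;> exact hus

/-- **The energy balance of the twisted Peierls transformation**:
`H(σ) - H(σ') ≥ 2U + 2 ∑_{u ∈ M} h'_u - 8d·𝟙[0 ∈ N] - 4·#(N ∩ (petals of 0 and -v))`.
[cite: FriedliVelenik2017, Lemma 3.36, eq. (3.37); VanenterFernandezSokal1993, App. B.5.3 eq. (B.71)] -/
theorem energy_ge :
    2 * (frusCount b σ S : ℝ) + 2 * ∑ u ∈ M, hf u - (if (0 : Site d) ∈ N then 8 * (d : ℝ) else 0)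
        - 4 * (#((minusSet L) ∩ (pet 0 ∪ pet (-(v)))) : ℝ) ≤ Hm σ - Hm σ' := by
  classical
  rw [h.hamiltonian_sub_eq, h.sum_oedges_union_eq]
  rw [← sum_filter_add_sum_filter_not (oedges S) (VV b), ← sum_filter_add_sum_filter_not EN (VV b)]
  have hA := h.termA_ge
  have hB := h.termB_ge
  -- the non-`VV` parts recombine into term C
  have hC : ∑ q ∈ (oedges S).filter (fun q => ¬ VV b q), g q + ∑ q ∈ (EN).filter (fun q => ¬ VV b q), g q =
      ∑ z ∈ (S ∪ N).filter (IsSpin b), (spinAt z σ' - spinAt z σ) * hf z := by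
    rw [← h.termC_eq, h.oedges_union_eq, filter_union, sum_union]
    exact disjoint_filter_filter h.disjoint_oedges_inN
  have hsplit : ∑ z ∈ (S ∪ N).filter (IsSpin b), (spinAt z σ' - spinAt z σ) * hf z =
      ∑ z ∈ S.filter (IsSpin b), (spinAt z σ' - spinAt z σ) * hf z + ∑ z ∈ N0, (spinAt z σ' - spinAt z σ) * hf z := by
    rw [filter_union, sum_union]
    rw [disjoint_left]; intro z hz hz'
    exact (h.not_mem_S_of_mem_N (mem_filter.1 hz').1).1 (mem_filter.1 hz).1
  have hCS := termC_S_eq (σ := σ) (S := S) (L := L) (b := b) (p := p) (R' := R')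
  have hCN := h.termC_N_ge
  have hM : ∑ u ∈ M, hf u = ∑ u ∈ Sm, hf u + ∑ u ∈ N0, hf u := sum_union h.disjoint_Sm_N0
  have key : ∑ q ∈ (oedges S).filter (VV b), g q + ∑ q ∈ (oedges S).filter (fun q => ¬ VV b q), g q +
      (∑ q ∈ (EN).filter (VV b), g q + ∑ q ∈ (EN).filter (fun q => ¬ VV b q), g q) =
      (∑ q ∈ (oedges S).filter (VV b), g q + ∑ q ∈ (EN).filter (VV b), g q) +
        (∑ q ∈ (oedges S).filter (fun q => ¬ VV b q), g q + ∑ q ∈ (EN).filter (fun q => ¬ VV b q), g q) := by ring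
  rw [key, hC, hsplit, hCS]
  split_ifs at hA hB ⊢ <;> linarith

/-! #### The Peierls condition controls the image field on `M` -/

/-- **The genuine image field and the tree's image field**: `imgField ξ u = h'_u + 𝟙[u ∼ 0]·p` — the
origin is an image site for `imgField` (value `ξ_p(0) = p`) but a spin here.
[cite: VanenterFernandezSokal1993, §4.3.2 and §4.1.2 Step 3] -/
theorem imgField_eq_gField_add (u : Site d) :
    imgField d b (ξb d b p R') u = hf u + if u ∈ pet 0 then ((p : ℤ) : ℝ) else 0 := by
  classical
  have h2 : hf u = ∑ a ∈ (imgNbrs d b u).filter (fun a => a ≠ 0), spinAt a (ξb d b p R') := by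
    rw [gField]
    refine sum_congr ?_ fun _ _ => rfl
    ext a; rw [mem_gimgNbrs, mem_filter, mem_imgNbrs, IsGImg, and_assoc]
  have hm2 : (0 : Site d) ∈ imgNbrs d b u ↔ u ∈ pet 0 := by
    rw [mem_imgNbrs, SimpleGraph.mem_neighborFinset]
    exact ⟨fun hh => hh.1.symm, fun hh => ⟨hh.symm, isSpImageSite_zero b⟩⟩
  rw [imgField, h2, sum_filter_ne_eq]
  by_cases hu : u ∈ pet 0
  · rw [if_pos (hm2.2 hu), if_pos hu, spinAt, ξb_zero h.hb0]; ring
  · rw [if_neg (fun hh => hu (hm2.1 hh)), if_neg hu]; ring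

/-- **The Peierls condition applied to `M`**: `2 ∑_{u ∈ M} h'_u ≥ -#(∂M) - 2k`, where `∂M = ffBdryPairs M`
are the boundary pairs of `M` towards internal sites and `k = #(M ∩ petals of 0)` (the tree's
`sum_imgField_ge`: `-∑_M imgField ξ ≤ #∂M / 2`, and `ξ_p` has isolated `-` image spins).
[cite: VanenterFernandezSokal1993, App. B.5.3 eqs. (B.71)–(B.77)] -/
theorem two_sum_gField_ge :
    -(#(ffBdryPairs d b M) : ℝ) - 2 * #((M) ∩ pet 0) ≤ 2 * ∑ u ∈ M, hf u := by
  classical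
  have hPS := sum_imgField_ge h.hd h.hb2 (minusIsolated_signedCoreAnnulusBC (d := d) h.hb0 p R') (M)
  have heq : ∑ u ∈ M, imgField d b (ξb d b p R') u = ∑ u ∈ M, hf u + ((p : ℤ) : ℝ) * #((M) ∩ pet 0) := by
    rw [sum_congr rfl fun u _ => h.imgField_eq_gField_add u, sum_add_distrib, ← sum_filter, sum_const, nsmul_eq_mul, mul_comm]
    have hset : (M).filter (fun u => u ∈ pet 0) = (M) ∩ pet 0 := by ext u; simp only [mem_filter, mem_inter]
    rw [hset]
  rw [ξb] at heq
  rw [heq] at hPS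
  have hp : ((p : ℤ) : ℝ) ≤ 1 := by rcases Int.units_eq_one_or p with hp | hp <;> simp [hp]
  have hk : (0 : ℝ) ≤ #((M) ∩ pet 0) := Nat.cast_nonneg _
  nlinarith

/-! #### Boundary pairs of `M` are frustrated bonds touching `S` -/

open Classical in
/-- **Orienting a pair of adjacent sites** as an oriented edge `(x, i)` with `{x, x + eᵢ} = {u, w}`. [folklore] -/
def orientPair (pr : Site d × Site d) : Site d × Fin d :=
  if hh : ∃ i, pr.2 = pr.1 + uvec i then (pr.1, hh.choose)
  else if hh' : ∃ i, pr.1 = pr.2 + uvec i then (pr.2, hh'.choose) else (pr.1, h.i₀)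

/-- The oriented edge of an adjacent pair has the pair as its set of endpoints. [folklore] -/
theorem oedgeToSym2_orientPair {u w : Site d} (hadj : (zdGraph d).Adj u w) : oedgeToSym2 (h.orientPair (u, w)) = s(u, w) := by
  classical
  unfold orientPair
  by_cases hh : ∃ i, (u, w).2 = (u, w).1 + uvec i
  · rw [dif_pos hh, oedgeToSym2]
    have := hh.choose_spec
    simp only at this ⊢
    rw [← this]
  · rw [dif_neg hh]
    have hh' : ∃ i, (u, w).1 = (u, w).2 + uvec i := by
      obtain ⟨i, hi | hi⟩ := exists_uvec_of_adj hadj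
      · exact absurd ⟨i, hi⟩ hh
      · exact ⟨i, hi⟩
    rw [dif_pos hh', oedgeToSym2]
    have := hh'.choose_spec
    simp only at this ⊢
    rw [← this, Sym2.eq_swap]

/-- The endpoints of the oriented edge of an adjacent pair. [folklore] -/
theorem orientPair_endpoints {u w : Site d} (hadj : (zdGraph d).Adj u w) :
    ((h.orientPair (u, w)).1 = u ∧ (h.orientPair (u, w)).1 + uvec (h.orientPair (u, w)).2 = w) ∨
      ((h.orientPair (u, w)).1 = w ∧ (h.orientPair (u, w)).1 + uvec (h.orientPair (u, w)).2 = u) := by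
  have := h.oedgeToSym2_orientPair hadj
  rw [oedgeToSym2, Sym2.eq, Sym2.rel_iff'] at this
  simp only [Prod.mk.injEq, Prod.swap_prod_mk] at this
  exact this

/-- **A boundary pair `(u, w)` of `M` towards an internal site is a frustrated bond touching `S`**:
`σ_u = -1`, `σ_w = +1`, and `u ∈ S` or `w ∈ S`. [cite: FriedliVelenik2017, Lemma 3.36 (contours separate the signs)] -/
theorem frus_of_mem_ffBdryPairs {u w : Site d} (huw : (u, w) ∈ ffBdryPairs d b M) :
    σ u = -1 ∧ σ w = 1 ∧ (u ∈ S ∨ w ∈ S) ∧ IsSpin b u ∧ IsSpin b w := by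
  obtain ⟨huM, hwM, hwi, hadj⟩ := mem_ffBdryPairs.1 huw
  simp only at huM hwM hwi hadj
  have hws : IsSpin b w := isSpin_of_not_isSpImageSite hwi
  have hwN : w ∉ N := fun hwN => hwM (mem_union_right _ (mem_filter.2 ⟨hwN, hws⟩))
  have hw1_of_S : w ∈ S → σ w = 1 := fun hwS =>
    (Int.units_eq_one_or (σ w)).resolve_right fun hneg => hwM (mem_union_left _ (mem_filter.2 ⟨mem_filter.2 ⟨hwS, hws⟩, hneg⟩))
  rcases mem_M_iff.1 huM with ⟨huS, hus, hneg⟩ | ⟨huN, hus⟩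
  · refine ⟨hneg, ?_, Or.inl huS, hus, hws⟩
    by_cases hwS : w ∈ S
    · exact hw1_of_S hwS
    · exact h.apply_eq_one_of_adj_S huS (zdGraph_le_zdStar hadj) hwS hwN hws
  · have hwS : w ∈ S := h.mem_S_of_adj_of_not_mem_N huN (zdGraph_le_zdStar hadj) hwN
    exact ⟨h.apply_eq_neg_one_of_mem_N huN hus hwN ((supDist_le_one_of_adj hadj).trans h.hr1), hw1_of_S hwS, Or.inr hwS, hus, hws⟩

/-- The oriented edge of a boundary pair of `M` is a frustrated spin–spin bond touching `S`. [cite: FriedliVelenik2017, Lemma 3.36] -/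
theorem orientPair_mem_of_mem_ffBdryPairs {u w : Site d} (huw : (u, w) ∈ ffBdryPairs d b M) :
    h.orientPair (u, w) ∈ (oedges S).filter (Frus b σ) := by
  obtain ⟨-, -, -, hadj⟩ := mem_ffBdryPairs.1 huw
  simp only at hadj
  obtain ⟨hu, hw, hS, hus, hws⟩ := h.frus_of_mem_ffBdryPairs huw
  rcases h.orientPair_endpoints hadj with ⟨e1, e2⟩ | ⟨e1, e2⟩
  · refine mem_filter.2 ⟨mem_oedges.2 (by rw [e2, e1]; exact hS), ⟨by rw [e1]; exact hus, by rw [e2]; exact hws⟩, ?_⟩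
    rw [e2, e1, hu, hw]; decide
  · refine mem_filter.2 ⟨mem_oedges.2 (by rw [e2, e1]; exact hS.symm), ⟨by rw [e1]; exact hws, by rw [e2]; exact hus⟩, ?_⟩
    rw [e2, e1, hu, hw]; decide

/-- **`#∂M ≤ U`**: orienting is injective on the boundary pairs of `M`. [cite: FriedliVelenik2017, Lemma 3.36] -/
theorem card_ffBdryPairs_le_frusCount : #(ffBdryPairs d b M) ≤ frusCount b σ S := by
  rw [frusCount]
  refine card_le_card_of_injOn (fun pr => h.orientPair pr) (fun pr hpr => ?_) (fun pr hpr pr' hpr' hh => ?_)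
  · obtain ⟨u, w⟩ := pr
    exact h.orientPair_mem_of_mem_ffBdryPairs hpr
  · obtain ⟨u, w⟩ := pr
    obtain ⟨u', w'⟩ := pr'
    have hadj := (mem_ffBdryPairs.1 (mem_coe.1 hpr)).2.2.2
    have hadj' := (mem_ffBdryPairs.1 (mem_coe.1 hpr')).2.2.2
    have huM := (mem_ffBdryPairs.1 (mem_coe.1 hpr)).1
    have hwM' := (mem_ffBdryPairs.1 (mem_coe.1 hpr')).2.1
    simp only at hadj hadj' huM hwM' hh
    have e := h.oedgeToSym2_orientPair hadj
    rw [hh, h.oedgeToSym2_orientPair hadj', Sym2.eq, Sym2.rel_iff'] at e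
    rcases e with e | e
    · exact e.symm
    · exfalso
      rw [Prod.swap_prod_mk, Prod.mk.injEq] at e
      exact hwM' (e.2 ▸ huM)

/-! #### (U1): every site of `S` is near a frustrated bond touching `S` -/

/-- **Contours are closed under `★`-steps through bad sites.** [cite: FriedliVelenik2017, §7.2.6] -/
theorem mem_S_of_adj_bad {s z : Site d} (hs : s ∈ S) (hz : IsBad b r σ z) (hadj : (zdStar d).Adj s z) : z ∈ S := by
  by_contra hzS
  exact h.contour.2 z (mem_exBoundary.2 ⟨hzS, s, hs, hadj⟩) hz

/-- A `★`-connected set of bad sites meeting `S` lies in `S`. [cite: FriedliVelenik2017, §7.2.6] -/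
theorem subset_S_of_starConn_bad {D : Finset (Site d)} (hD : StarConn (D : Set (Site d))) (hbad : ∀ z ∈ D, IsBad b r σ z)
    {y : Site d} (hyD : y ∈ D) (hyS : y ∈ S) : D ⊆ S := by
  intro z hz
  have hchain := hD y (mem_coe.2 hyD) z (mem_coe.2 hz)
  have key : ∀ w, ReflTransGen (starRel (D : Set (Site d))) y w → w ∈ S := by
    intro w hw
    induction hw with
    | refl => exact hyS
    | tail _ hbc ih => exact h.mem_S_of_adj_bad ih (hbad _ (mem_coe.1 hbc.2.2)) hbc.1
  exact key z hchain

/-- **Every site of `S` is within `r` of a frustrated spin–spin bond lying in `S`**: a bad ball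
contains a frustrated pair of adjacent spin sites (`exists_frustrated_adj`), and the intersection of their
balls is a `★`-connected set of bad sites through the site, hence inside `S`.
[cite: FriedliVelenik2017, §7.2.1 and Lemma 3.36 (|γ̄| controls the number of boundary edges)] -/
theorem exists_frus_near {y : Site d} (hy : y ∈ S) :
    ∃ q ∈ (oedges S).filter (Frus b σ), q.1 ∈ supBall r y := by
  obtain ⟨z, hz, z', hz', hzs, hz's, hne⟩ := h.contour.1 y hy
  -- order the two spins
  obtain ⟨zm, zp, hzm, hzp, hzms, hzps, hm, hp⟩ : ∃ zm zp, zm ∈ supBall r y ∧ zp ∈ supBall r y ∧ IsSpin b zm ∧ IsSpin b zp ∧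
      σ zm = -1 ∧ σ zp = 1 := by
    rcases Int.units_eq_one_or (σ z) with h1 | h1 <;> rcases Int.units_eq_one_or (σ z') with h2 | h2
    · exact absurd (h1.trans h2.symm) hne
    · exact ⟨z', z, hz', hz, hz's, hzs, h2, h1⟩
    · exact ⟨z, z', hz, hz', hzs, hz's, h1, h2⟩
    · exact absurd (h1.trans h2.symm) hne
  obtain ⟨u, hu, w, hw, hus, hws, hadj, hσu, hσw⟩ := exists_frustrated_adj h.hd h.hb2 h.hr1 hzm hzp hzms hzps hm hp
  -- the intersection of the balls of `u` and `w` is a `★`-connected set of bad sites through `y`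
  set D := supBall r u ∩ supBall r w with hD
  have hyD : y ∈ D := mem_inter.2 ⟨mem_supBall_symm hu, mem_supBall_symm hw⟩
  have hbad : ∀ t ∈ D, IsBad b r σ t := fun t ht =>
    ⟨u, mem_supBall_symm (mem_inter.1 ht).1, w, mem_supBall_symm (mem_inter.1 ht).2, hus, hws, by rw [hσu, hσw]; decide⟩
  have hDS : D ⊆ S := h.subset_S_of_starConn_bad (starConn_supBall_inter r u w) hbad hyD hy
  have huS : u ∈ S := hDS (mem_inter.2 ⟨mem_supBall_self r u, mem_supBall_symm (mem_supBall.2 (supDist_le_one_of_adj hadj |>.trans h.hr1))⟩)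
  have hwS : w ∈ S := hDS (mem_inter.2 ⟨mem_supBall.2 (supDist_le_one_of_adj hadj |>.trans h.hr1), mem_supBall_self r w⟩)
  refine ⟨h.orientPair (u, w), ?_, ?_⟩
  · rcases h.orientPair_endpoints hadj with ⟨e1, e2⟩ | ⟨e1, e2⟩
    · refine mem_filter.2 ⟨mem_oedges.2 (Or.inl (by rw [e1]; exact huS)), ⟨by rw [e1]; exact hus, by rw [e2]; exact hws⟩, ?_⟩
      rw [e2, e1, hσu, hσw]; decide
    · refine mem_filter.2 ⟨mem_oedges.2 (Or.inl (by rw [e1]; exact hwS)), ⟨by rw [e1]; exact hws, by rw [e2]; exact hus⟩, ?_⟩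
      rw [e2, e1, hσu, hσw]; decide
  · rcases h.orientPair_endpoints hadj with ⟨e1, -⟩ | ⟨e1, -⟩
    · rw [e1]; exact hu
    · rw [e1]; exact hw

/-- **(U1) `|S| ≤ (2r+1)^d · U`.** [cite: FriedliVelenik2017, Lemma 3.36 and Lemma 7.30] -/
theorem card_S_le : #S ≤ (2 * r + 1) ^ d * frusCount b σ S := by
  classical
  choose fq hfq hfB using fun y (hy : y ∈ S) => h.exists_frus_near hy
  set F : Site d → Site d × Fin d := fun y => if hy : y ∈ S then fq y hy else ((0 : Site d), h.i₀) with hF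
  have hFmem : ∀ y ∈ S, F y ∈ (oedges S).filter (Frus b σ) ∧ (F y).1 ∈ supBall r y := fun y hy => by
    simp only [hF, dif_pos hy]; exact ⟨hfq y hy, hfB y hy⟩
  calc #S ≤ (2 * r + 1) ^ d * #(S.image F) := by
        refine card_le_mul_card_image S _ fun q hq => ?_
        calc #(S.filter fun y => F y = q) ≤ #(supBall r q.1) := card_le_card fun y hy => by
              obtain ⟨hyS, hyq⟩ := mem_filter.1 hy
              rw [← hyq]; exact mem_supBall_symm (hFmem y hyS).2
          _ = (2 * r + 1) ^ d := card_supBall r _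
    _ ≤ (2 * r + 1) ^ d * frusCount b σ S := by
        refine Nat.mul_le_mul_left _ (card_le_card fun q hq => ?_)
        obtain ⟨y, hy, rfl⟩ := mem_image.1 hq
        exact (hFmem y hy).1

/-! #### (U3): a `-` component forces many boundary pairs -/

/-- The sign version of `apply_eq_one_of_adj_S`: a good neighbour of `S` outside `S ∪ N` has sign `+1`.
[cite: FriedliVelenik2017, §7.2.6 (labels)] -/
theorem bsign_eq_one_of_adj_S {z s : Site d} (hs : s ∈ S) (hadj : (zdStar d).Adj s z) (hzS : z ∉ S) (hzN : z ∉ N) :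
    ¬ IsBad b r σ z ∧ bsign b r σ z = 1 := by
  have hzex : z ∈ exBoundary S := mem_exBoundary.2 ⟨hzS, s, hs, hadj⟩
  have hgood : ¬ IsBad b r σ z := h.contour.2 z hzex
  refine ⟨hgood, ?_⟩
  rcases mem_starExt_or_mem_starInt h.hd hzS with hext | hint
  · exact h.plusExt z hzex hext
  · obtain ⟨A, hA, hzA⟩ := exists_mem_Comps h.hd h.ne hint
    have hAL : A ∉ L := fun hAL => hzN (mem_minusSet.2 ⟨A, hAL, hzA⟩)
    have hnm : ¬ IsMinusComp b r σ A := fun hm => hAL ((h.Lspec A hA).2 hm)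
    exact bsign_eq_one_of_not_isMinusComp h.hd h.hb2 h.hr2 h.conn h.contour hA hnm
      (mem_inBoundary.2 ⟨hzA, s, fun hsA => (not_mem_of_mem_Comps h.hd hA hsA).1 hs, hadj.symm⟩)

/-- **The `r`-ball of an interior-boundary site of a `-` component lies in `M`** (its spin sites): such a
ball carries only `-` spins, and a `-` spin site outside `S ∪ N` would be separated from the component by
a good neighbour of `S` of sign `+1` inside the ball. [cite: FriedliVelenik2017, §7.2.6] -/
theorem mem_M_of_mem_supBall {A : Finset (Site d)} (hA : A ∈ L) {v₀ : Site d} (hv₀ : v₀ ∈ inBoundary A) {z : Site d}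
    (hz : z ∈ supBall r v₀) (hzs : IsSpin b z) : z ∈ M := by
  have hAc := h.mem_Comps_of_mem_L hA
  have hgood : ¬ IsBad b r σ v₀ := h.contour.2 v₀ (mem_exBoundary_of_mem_inBoundary h.hd hAc hv₀)
  have hsv : bsign b r σ v₀ = -1 := h.isMinusComp_of_mem_L hA v₀ hv₀
  have hball : ∀ t ∈ supBall r v₀, IsSpin b t → σ t = -1 := fun t ht hts => by rw [apply_eq_bsign hgood ht hts, hsv]
  have hz1 : σ z = -1 := hball z hz hzs
  by_contra hzM
  have hzS : z ∉ S := fun hzS => hzM (mem_union_left _ (mem_filter.2 ⟨mem_filter.2 ⟨hzS, hzs⟩, hz1⟩))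
  have hzN : z ∉ N := fun hzN => hzM (mem_union_right _ (mem_filter.2 ⟨hzN, hzs⟩))
  have hv₀N : v₀ ∈ N := mem_minusSet.2 ⟨A, hA, (mem_inBoundary.1 hv₀).1⟩
  obtain ⟨t, t', ht, ht', hadj, htbox, ht'box⟩ :=
    exists_adj_exit ({x | x ∉ S ∧ x ∉ N} : Set (Site d)) (u := z) (y := v₀) ⟨hzS, hzN⟩ (fun hh => hh.2 hv₀N)
  have hv₀B : v₀ ∈ supBall r v₀ := mem_supBall_self r v₀
  have htB : t ∈ supBall r v₀ := mem_supBall_of_mem_cbox hz hv₀B htbox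
  have ht'B : t' ∈ supBall r v₀ := mem_supBall_of_mem_cbox hz hv₀B ht'box
  -- `t' ∈ S`
  have ht'S : t' ∈ S := by
    simp only [Set.mem_setOf_eq, not_and_or, not_not] at ht'
    rcases ht' with ht'S | ht'N
    · exact ht'S
    · exact absurd (h.mem_N_of_adj ht'N (zdGraph_le_zdStar hadj).symm ht.1) ht.2
  obtain ⟨htgood, htsign⟩ := h.bsign_eq_one_of_adj_S ht'S (zdGraph_le_zdStar hadj).symm ht.1 ht.2
  -- a spin site of both balls
  by_cases hts : IsSpin b t
  · have e1 : σ t = 1 := by rw [apply_eq_bsign htgood (mem_supBall_self r t) hts, htsign]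
    rw [hball t htB hts] at e1; exact absurd e1 (by decide)
  · have htimg : IsSpImageSite d b t := (of_not_not fun hh => hts (isSpin_iff_not_isGImg.2 hh)).1
    have ht's : IsSpin b t' := isSpin_of_adj_isSpImageSite h.hb2 htimg hadj
    have e1 : σ t' = 1 := by
      rw [apply_eq_bsign htgood (mem_supBall.2 ((supDist_le_one_of_adj hadj).trans h.hr1)) ht's, htsign]
    rw [hball t' ht'B ht's] at e1; exact absurd e1 (by decide)

/-- The second axis `e₁`. [folklore] -/
def i₁ : Fin d := ⟨1, by have := h.hd; omega⟩

/-- `e₁ ≠ e₀`. [folklore] -/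
theorem i₁_ne_i₀ : h.i₁ ≠ h.i₀ := by simp [CtData.i₁, CtData.i₀, Fin.ext_iff]

/-- **(U3) A `-` component forces `2r` boundary pairs of `M`**: the `r`-ball of an interior-boundary site
of the component lies in `M`; it meets at least `r` lines in direction `e₀` consisting of internal sites
(second coordinate not divisible by `b`), and every such line leaves `M` forwards and backwards through
boundary pairs towards internal sites. [cite: FriedliVelenik2017, §7.4.3 (large contours); VanenterFernandezSokal1993, App. B.5.3] -/
theorem two_mul_r_le_card_ffBdryPairs (hN : (minusSet L).Nonempty) : 2 * r ≤ #(ffBdryPairs d b M) := by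
  classical
  obtain ⟨u, hu⟩ := hN
  obtain ⟨A, hA, huA⟩ := mem_minusSet.1 hu
  obtain ⟨v₀, hv₀⟩ := inBoundary_nonempty h.hd1 ⟨u, huA⟩
  set M' := (M).filter (fun x => ¬ (b : ℤ) ∣ x h.i₁) with hM'
  have hne := h.i₁_ne_i₀
  -- forward and backward exits of `M'` in direction `e₀` are boundary pairs of `M`
  have hcoordf : ∀ x : Site d, (x + uvec h.i₀) h.i₁ = x h.i₁ := fun x => by
    rw [Pi.add_apply, uvec_apply, if_neg hne, add_zero]
  have hcoordb : ∀ x : Site d, (x - uvec h.i₀) h.i₁ = x h.i₁ := fun x => by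
    rw [Pi.sub_apply, uvec_apply, if_neg hne, sub_zero]
  have hfwd : ∀ x ∈ fwdExits M' h.i₀, (x, x + uvec h.i₀) ∈ ffBdryPairs d b M := by
    intro x hx
    obtain ⟨hxM', hout⟩ := mem_fwdExits.1 hx
    obtain ⟨hxM, hxd⟩ := mem_filter.1 hxM'
    refine mem_ffBdryPairs.2 ⟨hxM, fun hh => hout (mem_filter.2 ⟨hh, by rw [hcoordf]; exact hxd⟩), fun himg => hxd ?_, zdGraph_adj_add_uvec _ _⟩
    rw [← hcoordf x]; exact himg h.i₁
  have hbwd : ∀ x ∈ bwdExits M' h.i₀, (x, x - uvec h.i₀) ∈ ffBdryPairs d b M := by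
    intro x hx
    obtain ⟨hxM', hout⟩ := mem_bwdExits.1 hx
    obtain ⟨hxM, hxd⟩ := mem_filter.1 hxM'
    refine mem_ffBdryPairs.2 ⟨hxM, fun hh => hout (mem_filter.2 ⟨hh, by rw [hcoordb]; exact hxd⟩), fun himg => hxd ?_, zdGraph_adj_sub_uvec' _ _⟩
    rw [← hcoordb x]; exact himg h.i₁
  -- so `#∂M ≥ #fwd + #bwd ≥ 2 · #lines`
  have hcount : #(fwdExits M' h.i₀) + #(bwdExits M' h.i₀) ≤ #(ffBdryPairs d b M) := by
    rw [← card_image_of_injective (fwdExits M' h.i₀) (f := fun x => (x, x + uvec h.i₀)) (fun x y hh => (Prod.mk.inj hh).1),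
      ← card_image_of_injective (bwdExits M' h.i₀) (f := fun x => (x, x - uvec h.i₀)) (fun x y hh => (Prod.mk.inj hh).1),
      ← card_union_of_disjoint]
    · refine card_le_card fun pr hpr => ?_
      rcases mem_union.1 hpr with hpr | hpr
      · obtain ⟨x, hx, rfl⟩ := mem_image.1 hpr; exact hfwd x hx
      · obtain ⟨x, hx, rfl⟩ := mem_image.1 hpr; exact hbwd x hx
    · rw [disjoint_left]
      intro pr h1 h2
      obtain ⟨x, -, rfl⟩ := mem_image.1 h1
      obtain ⟨x', -, hh⟩ := mem_image.1 h2
      obtain ⟨rfl, h2⟩ := Prod.mk.inj hh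
      rw [sub_eq_add_neg] at h2
      have e := add_left_cancel h2
      exact uvec_add_uvec_ne_zero h.i₀ h.i₀ (by nth_rw 1 [← e]; rw [neg_add_cancel])
  have hlines := card_image_lineKey_le_card_fwdExits M' h.i₀
  have hlines' := card_image_lineKey_le_card_bwdExits M' h.i₀
  -- at least `r` internal lines meet the ball, hence `M'`
  have hr : r ≤ #(M'.image (lineKey h.i₀)) := by
    set c : ℤ := v₀ h.i₁ with hc
    let tj : ℕ → ℤ := fun j => if (b : ℤ) ∣ c + (-(r : ℤ) + 2 * j) then -(r : ℤ) + 2 * j + 1 else -(r : ℤ) + 2 * j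
    let yj : ℕ → Site d := fun j => v₀ + tj j • uvec h.i₁
    have htj : ∀ j, j < r → -(r : ℤ) ≤ tj j ∧ tj j ≤ r ∧ -(r : ℤ) + 2 * j ≤ tj j ∧ tj j ≤ -(r : ℤ) + 2 * j + 1 ∧ ¬ (b : ℤ) ∣ c + tj j := by
      intro j hj
      simp only [tj]
      split_ifs with hdvd
      · refine ⟨by omega, by omega, by omega, by omega, fun h2 => ?_⟩
        have : (b : ℤ) ∣ 1 := by
          have := dvd_sub h2 hdvd; rw [show c + (-(r : ℤ) + 2 * j + 1) - (c + (-(r : ℤ) + 2 * j)) = 1 by ring] at this; exact this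
        have := Int.le_of_dvd one_pos this; have := h.hb2; omega
      · exact ⟨by omega, by omega, by omega, by omega, hdvd⟩
    have hyj : ∀ j, j < r → yj j ∈ M' := by
      intro j hj
      obtain ⟨h1, h2, -, -, h5⟩ := htj j hj
      have hyc : yj j h.i₁ = c + tj j := by simp [yj, hc, uvec]
      have hys : IsSpin b (yj j) := isSpin_of_not_isSpImageSite (not_isSpImageSite_of_not_dvd h.i₁ (by rw [hyc]; exact h5))
      have hyB : yj j ∈ supBall r v₀ := mem_supBall_iff_forall.2 fun m => by
        simp only [yj, Pi.add_apply, Pi.smul_apply, uvec_apply, smul_eq_mul, mul_ite, mul_one, mul_zero]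
        split_ifs <;> omega
      exact mem_filter.2 ⟨h.mem_M_of_mem_supBall hA hv₀ hyB hys, by rw [hyc]; exact h5⟩
    calc r = #(range r) := (card_range r).symm
      _ ≤ #(M'.image (lineKey h.i₀)) := card_le_card_of_injOn (fun j => lineKey h.i₀ (yj j)) (fun j hj => mem_image_of_mem _ (hyj j (mem_range.1 hj)))
          (fun j hj j' hj' hh => by
            have e := (lineKey_eq_iff.1 hh) h.i₁ hne
            simp only [yj, Pi.add_apply, Pi.smul_apply, uvec_apply, smul_eq_mul, add_right_inj] at e
            have := htj j (mem_range.1 hj); have := htj j' (mem_range.1 hj')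
            simp only [tj] at e
            split_ifs at e <;> omega)
  omega

/-! #### The gain of the transformation -/

omit h in
/-- `#(petals of a) = 2d`. [cite: FriedliVelenik2017, §3.1] -/
theorem card_pet (a : Site d) : #(pet a) = 2 * d := (card_neighborFinset_zdGraph_holds (d := d)) a

/-- **The energy gain of the twisted Peierls transformation**: `H(σ) - H(σ') ≥ U / 6`, where `U` is the
number of frustrated spin–spin bonds touching the contour (Peierls condition for the field terms,
`3k ≤ #∂M ≤ U` for the origin correction, and `U ≥ 2r ≥ 144 d` whenever the `-` interior is nonempty, which
absorbs the bounded defects of the free origin). [cite: FriedliVelenik2017, Lemma 3.36; VanenterFernandezSokal1993, App. B.5.3 (B.75)–(B.77)] -/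
theorem frusCount_div_le_gain : (frusCount b σ S : ℝ) / 6 ≤ Hm σ - Hm σ' := by
  have hE := h.energy_ge
  have hPS := h.two_sum_gField_ge
  have hff : (#(ffBdryPairs d b M) : ℝ) ≤ frusCount b σ S := by exact_mod_cast h.card_ffBdryPairs_le_frusCount
  have h3k : 3 * (#((M) ∩ pet 0) : ℝ) ≤ #(ffBdryPairs d b M) := by exact_mod_cast three_mul_card_petals_le h.hd h.hb (M)
  -- the defects
  have hdef : (if (0 : Site d) ∈ N then 8 * (d : ℝ) else 0) + 4 * (#((minusSet L) ∩ (pet 0 ∪ pet (-(v)))) : ℝ) ≤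
      (frusCount b σ S : ℝ) / 6 := by
    by_cases hN : (minusSet L).Nonempty
    · have h2r : 2 * (r : ℝ) ≤ #(ffBdryPairs d b M) := by exact_mod_cast h.two_mul_r_le_card_ffBdryPairs hN
      have hpet : (#((minusSet L) ∩ (pet 0 ∪ pet (-(v)))) : ℝ) ≤ 4 * d := by
        have := (card_le_card (inter_subset_right (s₁ := minusSet L) (s₂ := pet 0 ∪ pet (-(v))))).trans (card_union_le _ _)
        rw [card_pet, card_pet] at this
        have : (#((minusSet L) ∩ (pet 0 ∪ pet (-(v)))) : ℝ) ≤ ((2 * d + 2 * d : ℕ) : ℝ) := by exact_mod_cast this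
        push_cast at this; linarith
      have hrd : (72 : ℝ) * d ≤ r := by exact_mod_cast h.hrd
      split_ifs <;> linarith
    · rw [not_nonempty_iff_eq_empty] at hN
      rw [hN]
      simp only [notMem_empty, if_false, empty_inter, card_empty, Nat.cast_zero, mul_zero, zero_add]
      positivity
  linarith

/-- **The Peierls estimate for one contour**: `H(σ') ≤ H(σ) - |S| / (6 (2r+1)^d)`.
[cite: FriedliVelenik2017, Lemma 3.36 and (7.30); VanenterFernandezSokal1993, App. B.5.3] -/
theorem card_div_le_gain : (#S : ℝ) / (6 * (2 * r + 1) ^ d) ≤ Hm σ - Hm σ' := by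
  have h1 := h.frusCount_div_le_gain
  have h2 : (#S : ℝ) ≤ (2 * r + 1) ^ d * frusCount b σ S := by exact_mod_cast h.card_S_le
  have hK : (0 : ℝ) < (2 * r + 1) ^ d := by positivity
  rw [div_le_iff₀ (by positivity)]
  calc (#S : ℝ) ≤ (2 * r + 1) ^ d * frusCount b σ S := h2
    _ = ((frusCount b σ S : ℝ) / 6) * (6 * (2 * r + 1) ^ d) := by ring
    _ ≤ (Hm σ - Hm σ') * (6 * (2 * r + 1) ^ d) := by gcongr

end CtData

end SpacingPeierls

end Literature.Barriers.CriticalPhenomena.NonGibbs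

end
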